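import Literature.NumberTheory.Sieve.IwaniecAlmostPrimes
import Literature.NumberTheory.Sieve.BetaSieveForward
import Literature.NumberTheory.LFunctions.MertensConstant
import HarnessLib

/-!
# Iwaniec (1978), §6: the weighted-sieve inequality (2) from Proposition 2 — PROVED layers

Continuation of `Literature/NumberTheory/Sieve/IwaniecAlmostPrimes.lean` (Iwaniec, Invent. Math.
**47** (1978) 171–188 [cite: IwaniecInventiones1978, §6 pp. 186–187]).  That file reduces parity.S19
to the named fact `weightedSum_lower` (display (2) p. 173 at `z = x^{1/5}`) and vendors Iwaniec's
Proposition 2 (`proposition2_upper`, `proposition2_lower`).  Here the whole of §6 between them is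
PROVED, with the Mertens-type inputs taken from the tree:

* `sum_siftedCount_le_four_mul` — the range `x^{1−ε} ≤ p < x` of (22): each sifted `n² + 1` has at
  most four prime factors `≥ x^{1/2}`, so `∑_{p ≥ x^{1−ε}} S(𝒜_p, z) ≤ 4 S(𝒜, z)` (no
  Brun–Titchmarsh bound is needed: the coefficients there are `≤ ε`);
* `weightedSum_ge_of_prop2` — from the identity (3) (proved in the first file), dropping the
  nonnegative double sum, and Proposition 2 applied to the four families of p. 186
  (`z_q = q`, `c_q = 1 − 2u`; `z_q = z`, `c_q = u`; `z_q = z`, `c_q = 1 − u` on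
  `x^{1/2} ≤ q < x^{1−ε}`; `q = 1`): for `0 < ε ≤ 1/4` and `x ≥ x₀(ε)`,
  `W(𝒜, z) ≥ V(z) x {f(16/3) − M_A(x) − M_B(x) − M₂(x, ε) − C ε}` with explicit prime sums `M_*`;
* `abs_sum_mul_sub_integral_le`, `tendsto_sum_Ioc_rhoWeight` — partial summation against
  `log log t` (Abel summation, integration by parts, the substitution `t = x^u`): if
  `∑_{k ≤ t} c_k = log log t + b + o(1)` then
  `∑_{x^α < k ≤ x^β} c_k g(log k/log x) → ∫_α^β g(u) du/u`
  for `g ∈ C¹[α, β]` (cf. arXiv:1910.02885, Lemmas 14–15);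
* `tendsto_sum_primesLE_rho_div_sub_loglog` (`∑_{p ≤ t} ρ(p)/p = log log t + b + o(1)`) and
  `tendsto_densityProd_mul_log` (`V(z) log z → 2Γ e^{-γ}`; the printed line on p. 187 drops the
  factor `g = 2`, harmlessly) — PROVED from `MertensConstant.lean` (Mertens II with its constant,
  Mertens' product theorem), `BatemanHornProofs.lean` and AZFG 2020 (5.4.4);
* `MA_le`, `MB_le`, `M2_le` — the three prime sums are asymptotically at most the integrals
  `T3 = ∫_{1/5}^{1/2} (1 − 2u)(γ/u) F((α − u)/u) du/u`, `T4 = ∫_{1/5}^{1/2} F((α − u)/γ) du`,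
  `T5 = ∫_{1/2}^{1} (1 − u) F((α − u)/γ) du/u` (`α = 16/15`, `γ = 1/5`; the weights are `C¹` by the
  regularity of `F` proved in the first file);
* `exists_isLinearSieveFunctions` — a pair `(F, f)` with `IsLinearSieveFunctions F f` EXISTS:
  the tree's forward `β`-sieve solution (`BetaSieveForward.lean`, method of steps) at `κ = 1`,
  `β = 2`, `A = 2e^γ`; so nothing quantified over the predicate is vacuous;
* `weightedSum_lower_of_prop2_of_numerics'` — **conclusion:**
  `proposition2_upper → proposition2_lower →
  (∀ F f, IsLinearSieveFunctions F f → e^γ/770 < f(16/3) − T3 − T4 − T5) → weightedSum_lower`;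
* `proposition2_lower_const` and the `_const` variants (`weightedSum_ge_of_prop2_const`, …,
  `weightedSum_lower_of_prop2_of_numerics'_const`): the same chain from the upper half and the
  CONSTANT-LEVEL lower half of Proposition 2 only (the lower bound is used solely through
  `S(𝒜, z)`, i.e. `q = 1`, `z_q = z`); `proposition2_lower → proposition2_lower_const`
  (`proposition2_lower.const`), and the original theorems are now one-line corollaries.  The
  constant-level lower half is what Lemma 2 and the Corollary of Proposition 1 yield directly
  (`IwaniecAlmostPrimesProp2*.lean`).

What remains for `weightedSum_lower` (hence parity.S19) below Proposition 2 is the numerical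
inequality `e^γ/770 < f(16/3) − T3 − T4 − T5` (numerically `0.00231 < 0.00600`; Iwaniec's p. 187
evaluation gives `W₅/(2e^γ γ) = 0.0140` with the double sum included), to be certified from the
p. 187 formulas for `F`, `f` in a sequel.

Design notes.  `RhoMertens` packages the `∑ ρ(p)/p` asymptotic as a hypothesis of the limit lemmas
(discharged at the end); `rhoWeight k = ρ(k)[k prime]/k` is the weight fed to Mathlib's Abel
summation `sum_mul_eq_sub_sub_integral_mul`; the endpoint discrepancy between `{x^α ≤ p < x^β}` and
`{x^α < k ≤ x^β}` is `≤ 2‖g‖∞ x^{-α}` (`sum_primesIn_le_sum_Ioc`, using `ρ(p) ≤ 2`).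
-/

open Filter Finset Real
open scoped ArithmeticFunction.Omega Polynomial Topology

noncomputable section

namespace Literature.NumberTheory.Sieve.Iwaniec1978

/-! ### The tail `x^{1−ε} ≤ p < x` of (22): at most four prime factors `≥ x^{1/2}` -/
section Tail
variable {x z : ℝ}

/-- For `x ≥ 2` and `1 ≤ n ≤ x`, at most four primes `p ≥ x^{1/2}` divide `n² + 1`
(their product divides `n² + 1 ≤ x² + 1 < x^{5/2}`). [folklore] -/
theorem card_filter_dvd_le_four (hx : 2 ≤ x) {n : ℕ} (hn : n ∈ Finset.Icc 1 ⌊x⌋₊) {a : ℝ}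
    (ha : x ^ (1 / 2 : ℝ) ≤ a) :
    ((primesIn a x).filter (fun p : ℕ => p ∣ n ^ 2 + 1)).card ≤ 4 := by
  set D := (primesIn a x).filter (fun p : ℕ => p ∣ n ^ 2 + 1) with hD
  by_contra hlt
  rw [not_le] at hlt
  have hx0 : 0 < x := by linarith
  have hx1 : 1 ≤ x := by linarith
  have hsq : 1 ≤ x ^ (1 / 2 : ℝ) := Real.one_le_rpow hx1 (by norm_num)
  have hprime : ∀ p ∈ D, p.Prime := fun p hp => (mem_primesIn.mp (Finset.mem_filter.mp hp).1).1
  have hdvd : ∀ p ∈ D, p ∣ n ^ 2 + 1 := fun p hp => (Finset.mem_filter.mp hp).2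
  have hge : ∀ p ∈ D, x ^ (1 / 2 : ℝ) ≤ (p : ℝ) := fun p hp =>
    ha.trans (mem_primesIn.mp (Finset.mem_filter.mp hp).1).2.1
  -- the product of the primes in `D` divides `n² + 1`
  have hprod : (∏ p ∈ D, p) ∣ n ^ 2 + 1 :=
    Finset.prod_primes_dvd _ (fun p hp => (hprime p hp).prime) hdvd
  have hle : ((∏ p ∈ D, p : ℕ) : ℝ) ≤ (n : ℝ) ^ 2 + 1 := by
    have := Nat.le_of_dvd (Nat.succ_pos _) hprod
    exact_mod_cast this
  -- and is at least `(x^{1/2})^{#D} ≥ x^{5/2}`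
  have hpow : (x ^ (1 / 2 : ℝ)) ^ D.card ≤ ((∏ p ∈ D, p : ℕ) : ℝ) := by
    rw [Nat.cast_prod]
    have h := Finset.prod_le_prod (s := D) (f := fun _ => x ^ (1 / 2 : ℝ))
      (g := fun p : ℕ => (p : ℝ))
      (fun _ _ => by positivity) (fun p hp => hge p hp)
    rwa [Finset.prod_const] at h
  have h5 : (x ^ (1 / 2 : ℝ)) ^ 5 ≤ (x ^ (1 / 2 : ℝ)) ^ D.card :=
    pow_le_pow_right₀ hsq hlt
  have hx52 : (x ^ (1 / 2 : ℝ)) ^ 5 = x ^ 2 * x ^ (1 / 2 : ℝ) := by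
    rw [← Real.rpow_natCast, ← Real.rpow_mul hx0.le]
    rw [show (1 / 2 : ℝ) * (5 : ℕ) = 2 + 1 / 2 by norm_num, Real.rpow_add hx0, Real.rpow_two]
  have hnx : (n : ℝ) ≤ x := by
    have h1 : (n : ℝ) ≤ ⌊x⌋₊ := by exact_mod_cast (Finset.mem_Icc.mp hn).2
    exact h1.trans (Nat.floor_le hx0.le)
  have hn0 : (0 : ℝ) ≤ n := Nat.cast_nonneg n
  -- `x² √x ≥ x² √2 > x² + 1`
  have hsqrt2 : Real.sqrt 2 ≤ x ^ (1 / 2 : ℝ) := by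
    rw [Real.sqrt_eq_rpow]; exact Real.rpow_le_rpow (by norm_num) hx (by norm_num)
  have hs2 : (1.4 : ℝ) < Real.sqrt 2 := by
    rw [show (1.4 : ℝ) = Real.sqrt (1.4 ^ 2) by rw [Real.sqrt_sq (by norm_num)]]
    exact Real.sqrt_lt_sqrt (by norm_num) (by norm_num)
  have key : (n : ℝ) ^ 2 + 1 < x ^ 2 * x ^ (1 / 2 : ℝ) := by
    have hx2 : (4 : ℝ) ≤ x ^ 2 := by nlinarith
    nlinarith [mul_le_mul_of_nonneg_left (hs2.le.trans hsqrt2) (by positivity : (0 : ℝ) ≤ x ^ 2)]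
  linarith [hle, hpow, h5]

/-- **Tail bound for §6 (22) — PROVED:** for `x ≥ 2`, `x^{1/2} ≤ a`:
`∑_{a ≤ p < x} S(𝒜_p, z) ≤ 4 S(𝒜, z)` (each sifted `a = n² + 1` is counted once for each of its at
most four prime factors `≥ x^{1/2}`). [cite: IwaniecInventiones1978, §6 (22)] -/
theorem sum_siftedCount_le_four_mul (hx : 2 ≤ x) {a : ℝ} (ha : x ^ (1 / 2 : ℝ) ≤ a) (z : ℝ) :
    ∑ p ∈ primesIn a x, (siftedCount x p z : ℝ) ≤ 4 * siftedCount x 1 z := by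
  have h1 : ∀ p ∈ primesIn a x, (siftedCount x p z : ℝ) =
      ∑ n ∈ siftedSet x z, if p ∣ n ^ 2 + 1 then (1 : ℝ) else 0 := by
    intro p _
    rw [Finset.sum_boole, siftedCount, ← filter_dvd_siftedSet]
  rw [Finset.sum_congr rfl h1, Finset.sum_comm, siftedCount_one]
  have h2 : ∀ n ∈ siftedSet x z,
      (∑ p ∈ primesIn a x, if p ∣ n ^ 2 + 1 then (1 : ℝ) else 0) ≤ 4 := by
    intro n hn
    rw [Finset.sum_boole]
    have := card_filter_dvd_le_four hx (mem_siftedSet.mp hn).1 ha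
    exact_mod_cast this
  calc ∑ n ∈ siftedSet x z, (∑ p ∈ primesIn a x, if p ∣ n ^ 2 + 1 then (1 : ℝ) else 0)
      ≤ ∑ n ∈ siftedSet x z, (4 : ℝ) := Finset.sum_le_sum h2
    _ = 4 * (siftedSet x z).card := by rw [Finset.sum_const, nsmul_eq_mul, mul_comm]

end Tail


/-! ### Proposition 2 specialised to families, and the assembled inequality of §6 -/
section Assembly
variable {x : ℝ}

/-- Sums over `Q` of a function vanishing off `T ⊆ Q` are sums over `T`. [folklore] -/
theorem sum_filter_support {T Q : Finset ℕ} {g : ℕ → ℝ} (hTQ : T ⊆ Q)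
    (hg : ∀ q, q ∉ T → g q = 0) : ∑ q ∈ Q, g q = ∑ q ∈ T, g q :=
  (Finset.sum_subset hTQ fun q _ hq => hg q hq).symm

/-- Membership in Prop. 2's index set `Q`. [folklore] -/
theorem mem_propQ {ε : ℝ} {zq : ℕ → ℝ} {q : ℕ} (h1 : 1 ≤ q) (h2 : (q : ℝ) < x ^ (1 - ε))
    (h3 : q.Coprime (primesProdBelow (zq q))) :
    q ∈ (Finset.Ico 1 ⌈x ^ (1 - ε)⌉₊).filter fun q : ℕ => q.Coprime (primesProdBelow (zq q)) := by
  rw [Finset.mem_filter, Finset.mem_Ico]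
  exact ⟨⟨h1, Nat.lt_ceil.mpr h2⟩, h3⟩

/-- **Prop. 2 (upper) for a family supported on a finset `T`** (the form in which it is applied on
p. 186). [cite: IwaniecInventiones1978, Proposition 2] -/
theorem prop2_upper_family (h2u : proposition2_upper) {F f : ℝ → ℝ}
    (hFf : IsLinearSieveFunctions F f) :
    ∃ Cu : ℝ, ∀ ε : ℝ, 0 < ε → ∃ x₀ : ℝ, ∀ x : ℝ, x₀ ≤ x →
      ∀ (T : Finset ℕ) (zq c : ℕ → ℝ),
        (∀ q, x ^ (1 / 5 : ℝ) ≤ zq q ∧ zq q < x ^ (1 / 2 : ℝ)) → (∀ q, 0 ≤ c q ∧ c q ≤ 1) →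
        (∀ q, q ∉ T → c q = 0) →
        (∀ q ∈ T, 1 ≤ q ∧ (q : ℝ) < x ^ (1 - ε) ∧ q.Coprime (primesProdBelow (zq q))) →
        ∑ q ∈ T, c q * (siftedCount x q (zq q) : ℝ) ≤
          densityProd (x ^ (1 / 5 : ℝ)) * x *
            (∑ q ∈ T, c q * (rho q : ℝ) / q *
                F (Real.log (x ^ (16 / 15 : ℝ) / q) / Real.log (zq q)) *
                  (Real.log (x ^ (1 / 5 : ℝ)) / Real.log (zq q)) + Cu * ε) := by
  obtain ⟨Cu, hCu⟩ := h2u F f hFf (1 / 5) (by norm_num) (by norm_num)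
  refine ⟨Cu, fun ε hε => ?_⟩
  obtain ⟨x₀, hx₀⟩ := hCu ε hε
  refine ⟨x₀, fun x hx T zq c hzq hc hcT hT => ?_⟩
  have h := hx₀ x hx zq c hzq hc
  simp only [] at h
  have hTQ : T ⊆ (Finset.Ico 1 ⌈x ^ (1 - ε)⌉₊).filter
      fun q : ℕ => q.Coprime (primesProdBelow (zq q)) :=
    fun q hq => mem_propQ (hT q hq).1 (hT q hq).2.1 (hT q hq).2.2
  rw [sum_filter_support hTQ (fun q hq => by rw [hcT q hq]; simp),
    sum_filter_support hTQ (fun q hq => by rw [hcT q hq]; simp)] at h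
  exact h

/-- **Prop. 2 (lower) for a family supported on a finset `T`.**
[cite: IwaniecInventiones1978, Proposition 2] -/
theorem prop2_lower_family (h2l : proposition2_lower) {F f : ℝ → ℝ}
    (hFf : IsLinearSieveFunctions F f) :
    ∃ Cl : ℝ, ∀ ε : ℝ, 0 < ε → ∃ x₀ : ℝ, ∀ x : ℝ, x₀ ≤ x →
      ∀ (T : Finset ℕ) (zq c : ℕ → ℝ),
        (∀ q, x ^ (1 / 5 : ℝ) ≤ zq q ∧ zq q < x ^ (1 / 2 : ℝ)) → (∀ q, 0 ≤ c q ∧ c q ≤ 1) →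
        (∀ q, q ∉ T → c q = 0) →
        (∀ q ∈ T, 1 ≤ q ∧ (q : ℝ) < x ^ (1 - ε) ∧ q.Coprime (primesProdBelow (zq q))) →
        densityProd (x ^ (1 / 5 : ℝ)) * x *
            (∑ q ∈ T, c q * (rho q : ℝ) / q *
                f (Real.log (x ^ (16 / 15 : ℝ) / q) / Real.log (zq q)) *
                  (Real.log (x ^ (1 / 5 : ℝ)) / Real.log (zq q)) - Cl * ε) ≤
          ∑ q ∈ T, c q * (siftedCount x q (zq q) : ℝ) := by
  obtain ⟨Cl, hCl⟩ := h2l F f hFf (1 / 5) (by norm_num) (by norm_num)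
  refine ⟨Cl, fun ε hε => ?_⟩
  obtain ⟨x₀, hx₀⟩ := hCl ε hε
  refine ⟨x₀, fun x hx T zq c hzq hc hcT hT => ?_⟩
  have h := hx₀ x hx zq c hzq hc
  simp only [] at h
  have hTQ : T ⊆ (Finset.Ico 1 ⌈x ^ (1 - ε)⌉₊).filter
      fun q : ℕ => q.Coprime (primesProdBelow (zq q)) :=
    fun q hq => mem_propQ (hT q hq).1 (hT q hq).2.1 (hT q hq).2.2
  rw [sum_filter_support hTQ (fun q hq => by rw [hcT q hq]; simp),
    sum_filter_support hTQ (fun q hq => by rw [hcT q hq]; simp)] at h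
  exact h

/-- **Proposition 2, lower bound, at a constant sieving level `Z`** (`z ≤ Z < x^{1/2}` the same
for all `q` — the form in which the lower bound is used in §6, through `S(𝒜, z)` alone):
`∑_{q<x^{1−ε}, (q,P(Z))=1} c_q S(𝒜_q; Z) > V(z) x {∑ c_q (ρ(q)/q) f(log(y/q)/log Z)(log z/log Z) − O_γ(ε)}`.
This is `proposition2_lower` specialised to constant `z_q` (`proposition2_lower.const`).  It is
singled out because it follows from Lemma 2 and the Corollary of Proposition 1 exactly as the upper
bound does (every `q` of a class is sieved at the level `Z` itself), whereas for varying `z_q` the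
monotonicity `S(𝒜_q, z_q) ≤ S(𝒜_q, Z)` used for the upper bound (p. 185) has no lower analogue.
[cite: IwaniecInventiones1978, Proposition 2] -/
def proposition2_lower_const : Prop :=
  ∀ (F f : ℝ → ℝ), IsLinearSieveFunctions F f →
    ∀ γ : ℝ, 0 < γ → γ < 1 / 2 → ∃ Cγ : ℝ, ∀ ε : ℝ, 0 < ε → ∃ x₀ : ℝ, ∀ x : ℝ, x₀ ≤ x →
      ∀ (Z : ℝ) (c : ℕ → ℝ), (x ^ γ ≤ Z ∧ Z < x ^ (1 / 2 : ℝ)) →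
        (∀ q, 0 ≤ c q ∧ c q ≤ 1) →
        let Q := (Finset.Ico 1 ⌈x ^ (1 - ε)⌉₊).filter fun q : ℕ =>
          q.Coprime (primesProdBelow Z)
        densityProd (x ^ γ) * x *
            (∑ q ∈ Q, c q * (rho q : ℝ) / q *
                f (Real.log (x ^ (16 / 15 : ℝ) / q) / Real.log Z) *
                  (Real.log (x ^ γ) / Real.log Z) - Cγ * ε) ≤
          ∑ q ∈ Q, c q * (siftedCount x q Z : ℝ)

/-- The lower half of Proposition 2 implies its constant-level form. [folklore] -/
theorem proposition2_lower.const (h : proposition2_lower) : proposition2_lower_const := by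
  intro F f hFf γ hγ hγ2
  obtain ⟨Cγ, hC⟩ := h F f hFf γ hγ hγ2
  refine ⟨Cγ, fun ε hε => ?_⟩
  obtain ⟨x₀, hx₀⟩ := hC ε hε
  refine ⟨x₀, fun x hx Z c hZ hc => ?_⟩
  exact hx₀ x hx (fun _ => Z) c (fun _ => hZ) hc

/-- **Prop. 2 (lower, constant level) for a family supported on a finset `T`.**
[cite: IwaniecInventiones1978, Proposition 2] -/
theorem prop2_lower_family_const (h2l : proposition2_lower_const) {F f : ℝ → ℝ}
    (hFf : IsLinearSieveFunctions F f) :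
    ∃ Cl : ℝ, ∀ ε : ℝ, 0 < ε → ∃ x₀ : ℝ, ∀ x : ℝ, x₀ ≤ x →
      ∀ (T : Finset ℕ) (Z : ℝ) (c : ℕ → ℝ),
        (x ^ (1 / 5 : ℝ) ≤ Z ∧ Z < x ^ (1 / 2 : ℝ)) → (∀ q, 0 ≤ c q ∧ c q ≤ 1) →
        (∀ q, q ∉ T → c q = 0) →
        (∀ q ∈ T, 1 ≤ q ∧ (q : ℝ) < x ^ (1 - ε) ∧ q.Coprime (primesProdBelow Z)) →
        densityProd (x ^ (1 / 5 : ℝ)) * x *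
            (∑ q ∈ T, c q * (rho q : ℝ) / q *
                f (Real.log (x ^ (16 / 15 : ℝ) / q) / Real.log Z) *
                  (Real.log (x ^ (1 / 5 : ℝ)) / Real.log Z) - Cl * ε) ≤
          ∑ q ∈ T, c q * (siftedCount x q Z : ℝ) := by
  obtain ⟨Cl, hCl⟩ := h2l F f hFf (1 / 5) (by norm_num) (by norm_num)
  refine ⟨Cl, fun ε hε => ?_⟩
  obtain ⟨x₀, hx₀⟩ := hCl ε hε
  refine ⟨x₀, fun x hx T Z c hZ hc hcT hT => ?_⟩
  have h := hx₀ x hx Z c hZ hc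
  simp only [] at h
  have hTQ : T ⊆ (Finset.Ico 1 ⌈x ^ (1 - ε)⌉₊).filter
      fun q : ℕ => q.Coprime (primesProdBelow Z) :=
    fun q hq => mem_propQ (zq := fun _ => Z) (hT q hq).1 (hT q hq).2.1 (hT q hq).2.2
  rw [sum_filter_support hTQ (fun q hq => by rw [hcT q hq]; simp),
    sum_filter_support hTQ (fun q hq => by rw [hcT q hq]; simp)] at h
  exact h

/-- Splitting a prime range at an intermediate point. [folklore] -/
theorem sum_primesIn_split {a m b : ℝ} (ham : a ≤ m) (hmb : m ≤ b) (g : ℕ → ℝ) :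
    ∑ p ∈ primesIn a b, g p = ∑ p ∈ primesIn a m, g p + ∑ p ∈ primesIn m b, g p := by
  rw [← Finset.sum_filter_add_sum_filter_not (primesIn a b) (fun p : ℕ => (p : ℝ) < m)]
  congr 1
  · congr 1; ext p
    simp only [Finset.mem_filter, mem_primesIn]
    exact ⟨fun ⟨⟨hp, ha, _⟩, hm⟩ => ⟨hp, ha, hm⟩,
      fun ⟨hp, ha, hm⟩ => ⟨⟨hp, ha, hm.trans_le hmb⟩, hm⟩⟩
  · congr 1; ext p
    simp only [Finset.mem_filter, mem_primesIn, not_lt]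
    exact ⟨fun ⟨⟨hp, _, hb⟩, hm⟩ => ⟨hp, hm, hb⟩, fun ⟨hp, hm, hb⟩ => ⟨⟨hp, ham.trans hm, hb⟩, hm⟩⟩

/-- `ρ(1) = 1`. [folklore] -/
theorem rho_one : rho 1 = 1 := by decide

/-- A prime `q` is coprime to `P(u)` whenever `u ≤ q`. [folklore] -/
theorem prime_coprime_primesProdBelow {q : ℕ} (hq : q.Prime) {u : ℝ} (hu : u ≤ (q : ℝ)) :
    q.Coprime (primesProdBelow u) := by
  rw [coprime_primesProdBelow_iff_forall]
  intro r hr hrq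
  rw [(Nat.prime_dvd_prime_iff_eq hr hq).mp hrq]
  exact hu

/-- **§6 assembled from Prop. 2 (without the double sum) — PROVED**, from the upper half and the
CONSTANT-LEVEL lower half of Proposition 2 (the lower bound enters only through `S(𝒜, z)`).  For `0 < ε ≤ 1/4` and
`x ≥ x₀(ε)`, with `z = x^{1/5}`, `y = x^{16/15}`, `L = log x`:
`W(𝒜, z) ≥ V(z) x {f(16/3) − Σ_A − Σ_B − Σ₂ − C ε}` where
`Σ_A = ∑_{z ≤ p < x^{1/2}} (1 − 2 log p/L)(ρ(p)/p) F(log(y/p)/log p)(log z/log p)`,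
`Σ_B = ∑_{z ≤ p < x^{1/2}} (log p/L)(ρ(p)/p) F(log(y/p)/log z)`,
`Σ₂ = ∑_{x^{1/2} ≤ p < x^{1−ε}} (1 − log p/L)(ρ(p)/p) F(log(y/p)/log z)`
(the double sum of (3) is dropped, being nonnegative; the range `x^{1−ε} ≤ p < x` of (22) is
absorbed by `sum_siftedCount_le_four_mul`). [cite: IwaniecInventiones1978, §6 pp. 186–187] -/
theorem weightedSum_ge_of_prop2_const (h2u : proposition2_upper) (h2l : proposition2_lower_const)
    {F f : ℝ → ℝ} (hFf : IsLinearSieveFunctions F f) :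
    ∃ C : ℝ, ∀ ε : ℝ, 0 < ε → ε ≤ 1 / 4 → ∃ x₀ : ℝ, ∀ x : ℝ, x₀ ≤ x →
      densityProd (x ^ (1 / 5 : ℝ)) * x *
        (f (16 / 3)
          - ∑ p ∈ primesIn (x ^ (1 / 5 : ℝ)) (x ^ (1 / 2 : ℝ)),
              (1 - 2 * Real.log p / Real.log x) * (rho p : ℝ) / p *
                F (Real.log (x ^ (16 / 15 : ℝ) / p) / Real.log p) *
                  (Real.log (x ^ (1 / 5 : ℝ)) / Real.log p)
          - ∑ p ∈ primesIn (x ^ (1 / 5 : ℝ)) (x ^ (1 / 2 : ℝ)),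
              Real.log p / Real.log x * (rho p : ℝ) / p *
                F (Real.log (x ^ (16 / 15 : ℝ) / p) / Real.log (x ^ (1 / 5 : ℝ)))
          - ∑ p ∈ primesIn (x ^ (1 / 2 : ℝ)) (x ^ (1 - ε)),
              (1 - Real.log p / Real.log x) * (rho p : ℝ) / p *
                F (Real.log (x ^ (16 / 15 : ℝ) / p) / Real.log (x ^ (1 / 5 : ℝ)))
          - C * ε) ≤
        weightedSum x (x ^ (1 / 5 : ℝ)) := by
  obtain ⟨Cu, hU⟩ := prop2_upper_family h2u hFf
  obtain ⟨Cl, hLo⟩ := prop2_lower_family_const h2l hFf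
  set Cu' := max Cu 0 with hCu'
  set Cl' := max Cl 0 with hCl'
  refine ⟨Cl' + 3 * Cu' + 4 * |f (16 / 3)|, fun ε hε hε4 => ?_⟩
  obtain ⟨xu, hxu⟩ := hU ε hε
  obtain ⟨xl, hxl⟩ := hLo ε hε
  refine ⟨max (max xu xl) 2, fun x hx => ?_⟩
  have hxu' : xu ≤ x := le_trans ((le_max_left _ _).trans (le_max_left _ _)) hx
  have hxl' : xl ≤ x := le_trans ((le_max_right _ _).trans (le_max_left _ _)) hx
  have hx2 : 2 ≤ x := le_trans (le_max_right _ _) hx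
  have hx1 : 1 < x := by linarith
  have hx0 : 0 < x := by linarith
  -- notation
  have hL0 : 0 < Real.log x := Real.log_pos hx1
  set z := x ^ (1 / 5 : ℝ) with hz
  set w := x ^ (1 / 2 : ℝ) with hw
  set v := x ^ (1 - ε) with hv
  have hz1 : 1 < z := Real.one_lt_rpow hx1 (by norm_num)
  have hzw : z < w := Real.rpow_lt_rpow_of_exponent_lt hx1 (by norm_num)
  have hwv : w ≤ v := Real.rpow_le_rpow_of_exponent_le hx1.le (by linarith)
  have hvx : v ≤ x := by
    conv_rhs => rw [← Real.rpow_one x]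
    exact Real.rpow_le_rpow_of_exponent_le hx1.le (by linarith)
  have h1v : (1 : ℝ) < v := Real.one_lt_rpow hx1 (by linarith)
  have hlogz : Real.log z = (1 / 5) * Real.log x := by rw [hz, Real.log_rpow hx0]
  have hlogz0 : Real.log z ≠ 0 := by rw [hlogz]; positivity
  have hV0 : 0 ≤ densityProd z * x := by
    refine mul_nonneg (Finset.prod_nonneg fun p hp => ?_) hx0.le
    have hpp : p.Prime := (Nat.mem_primesBelow.mp hp).2
    have hlt : polyRootCountMod ![(Polynomial.X ^ 2 + 1 : ℤ[X])] p < p :=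
      isBatemanHornSystem_X_sq_add_one.hasNoFixedPrimeDivisor p hpp
    rw [rho_eq_polyRootCountMod, sub_nonneg, div_le_one (by exact_mod_cast hpp.pos)]
    exact_mod_cast hlt.le
  set P₁ := primesIn z w with hP₁
  set P₂ := primesIn w v with hP₂
  set P₃ := primesIn v x with hP₃
  -- abbreviations
  set S₁ := (siftedCount x 1 z : ℝ) with hS₁
  set UA := ∑ p ∈ P₁, (1 - 2 * Real.log p / Real.log x) * (siftedCount x p p : ℝ) with hUA
  set UB := ∑ p ∈ P₁, Real.log p / Real.log x * (siftedCount x p z : ℝ) with hUB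
  set U2 := ∑ p ∈ P₂, (1 - Real.log p / Real.log x) * (siftedCount x p z : ℝ) with hU2
  set U3 := ∑ p ∈ P₃, (1 - Real.log p / Real.log x) * (siftedCount x p z : ℝ) with hU3
  set D := ∑ p ∈ P₁, ∑ p₁ ∈ primesIn z p,
      Real.log ((p : ℝ) / p₁) / Real.log x * (siftedCount x (p * p₁) p₁ : ℝ) with hDdef
  set MA := ∑ p ∈ P₁, (1 - 2 * Real.log p / Real.log x) * (rho p : ℝ) / p *
      F (Real.log (x ^ (16 / 15 : ℝ) / p) / Real.log p) * (Real.log z / Real.log p) with hMA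
  set MB := ∑ p ∈ P₁, Real.log p / Real.log x * (rho p : ℝ) / p *
      F (Real.log (x ^ (16 / 15 : ℝ) / p) / Real.log z) with hMB
  set M2 := ∑ p ∈ P₂, (1 - Real.log p / Real.log x) * (rho p : ℝ) / p *
      F (Real.log (x ^ (16 / 15 : ℝ) / p) / Real.log z) with hM2
  set V := densityProd z * x with hVdef
  -- (3) and dropping the double sum
  have h3 := weightedSum_eq (x := x) (z := z) hx1.le hzw.le
  have hD : 0 ≤ D := by
    refine Finset.sum_nonneg fun p hp => Finset.sum_nonneg fun p₁ hp₁ => ?_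
    have hpp := (mem_primesIn.mp hp₁)
    have hp1pos : (0 : ℝ) < p₁ := by exact_mod_cast hpp.1.pos
    refine mul_nonneg (div_nonneg (Real.log_nonneg ?_) hL0.le) (Nat.cast_nonneg _)
    rw [le_div_iff₀ hp1pos, one_mul]; exact hpp.2.2.le
  -- the tail `x^{1-ε} ≤ p < x`
  have htail : U3 ≤ ε * (4 * S₁) := by
    have h1 : ∀ p ∈ P₃, (1 - Real.log p / Real.log x) * (siftedCount x p z : ℝ) ≤
        ε * siftedCount x p z := by
      intro p hp
      have hpp := mem_primesIn.mp hp
      refine mul_le_mul_of_nonneg_right ?_ (Nat.cast_nonneg _)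
      have hp0 : (0 : ℝ) < p := by exact_mod_cast hpp.1.pos
      have : (1 - ε) * Real.log x ≤ Real.log p := by
        rw [← Real.log_rpow hx0]; exact Real.log_le_log (by positivity) hpp.2.1
      rw [sub_le_comm, le_div_iff₀ hL0]; linarith
    refine (Finset.sum_le_sum h1).trans ?_
    rw [← Finset.mul_sum]
    exact mul_le_mul_of_nonneg_left (sum_siftedCount_le_four_mul hx2 hwv z) hε.le
  -- family A : `T = P₁`, `z_q = q`, `c_q = 1 − 2 log q / L`
  have hA := hxu x hxu' P₁ (fun q => if q ∈ P₁ then (q : ℝ) else z)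
    (fun q => if q ∈ P₁ then 1 - 2 * Real.log q / Real.log x else 0) ?_ ?_ ?_ ?_
  rotate_left
  · intro q
    by_cases hq : q ∈ P₁
    · rw [if_pos hq]; exact ⟨(mem_primesIn.mp hq).2.1, (mem_primesIn.mp hq).2.2⟩
    · rw [if_neg hq]; exact ⟨le_rfl, hzw⟩
  · intro q
    by_cases hq : q ∈ P₁
    · rw [if_pos hq]
      have hpp := mem_primesIn.mp hq
      have hq0 : (0 : ℝ) < q := by exact_mod_cast hpp.1.pos
      have hlog0 : 0 ≤ Real.log q := Real.log_nonneg (by exact_mod_cast hpp.1.one_lt.le)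
      have hloglt : Real.log q < (1 / 2) * Real.log x := by
        rw [← Real.log_rpow hx0]; exact Real.log_lt_log hq0 hpp.2.2
      constructor
      · rw [sub_nonneg, div_le_one hL0]; linarith
      · rw [sub_le_self_iff]; positivity
    · rw [if_neg hq]; exact ⟨le_rfl, zero_le_one⟩
  · intro q hq; rw [if_neg hq]
  · intro q hq
    have hpp := mem_primesIn.mp hq
    refine ⟨hpp.1.pos, hpp.2.2.trans_le hwv, ?_⟩
    rw [if_pos hq]
    exact prime_coprime_primesProdBelow hpp.1 le_rfl
  have hA' : UA ≤ V * (MA + Cu * ε) := by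
    refine le_of_eq_of_le ?_ (hA.trans (le_of_eq ?_))
    · exact Finset.sum_congr rfl fun q hq => by simp only [if_pos hq]
    · congr 2
      exact Finset.sum_congr rfl fun q hq => by simp only [if_pos hq, hz]
  -- family B : `T = P₁`, `z_q = z`, `c_q = log q / L`
  have hB := hxu x hxu' P₁ (fun _ => z)
    (fun q => if q ∈ P₁ then Real.log q / Real.log x else 0) (fun _ => ⟨le_rfl, hzw⟩) ?_ ?_ ?_
  rotate_left
  · intro q
    by_cases hq : q ∈ P₁
    · rw [if_pos hq]
      have hpp := mem_primesIn.mp hq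
      have hq0 : (0 : ℝ) < q := by exact_mod_cast hpp.1.pos
      have hlog0 : 0 ≤ Real.log q := Real.log_nonneg (by exact_mod_cast hpp.1.one_lt.le)
      have hloglt : Real.log q < (1 / 2) * Real.log x := by
        rw [← Real.log_rpow hx0]; exact Real.log_lt_log hq0 hpp.2.2
      exact ⟨div_nonneg hlog0 hL0.le, by rw [div_le_one hL0]; linarith⟩
    · rw [if_neg hq]; exact ⟨le_rfl, zero_le_one⟩
  · intro q hq; rw [if_neg hq]
  · intro q hq
    have hpp := mem_primesIn.mp hq
    exact ⟨hpp.1.pos, hpp.2.2.trans_le hwv, prime_coprime_primesProdBelow hpp.1 hpp.2.1⟩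
  have hB' : UB ≤ V * (MB + Cu * ε) := by
    refine le_of_eq_of_le ?_ (hB.trans (le_of_eq ?_))
    · exact Finset.sum_congr rfl fun q hq => by simp only [if_pos hq]
    · congr 2
      exact Finset.sum_congr rfl fun q hq => by
        simp only [if_pos hq]; rw [div_self hlogz0, mul_one]
  -- family 2 : `T = P₂`, `z_q = z`, `c_q = 1 − log q / L`
  have hC2 := hxu x hxu' P₂ (fun _ => z)
    (fun q => if q ∈ P₂ then 1 - Real.log q / Real.log x else 0) (fun _ => ⟨le_rfl, hzw⟩) ?_ ?_ ?_
  rotate_left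
  · intro q
    by_cases hq : q ∈ P₂
    · rw [if_pos hq]
      have hpp := mem_primesIn.mp hq
      have hq0 : (0 : ℝ) < q := by exact_mod_cast hpp.1.pos
      have hlog0 : 0 ≤ Real.log q := Real.log_nonneg (by exact_mod_cast hpp.1.one_lt.le)
      have hloglt : Real.log q ≤ Real.log x := Real.log_le_log hq0 (hpp.2.2.le.trans hvx)
      constructor
      · rw [sub_nonneg, div_le_one hL0]; exact hloglt
      · rw [sub_le_self_iff]; positivity
    · rw [if_neg hq]; exact ⟨le_rfl, zero_le_one⟩
  · intro q hq; rw [if_neg hq]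
  · intro q hq
    have hpp := mem_primesIn.mp hq
    exact ⟨hpp.1.pos, hpp.2.2, prime_coprime_primesProdBelow hpp.1 (hzw.le.trans hpp.2.1)⟩
  have hC2' : U2 ≤ V * (M2 + Cu * ε) := by
    refine le_of_eq_of_le ?_ (hC2.trans (le_of_eq ?_))
    · exact Finset.sum_congr rfl fun q hq => by simp only [if_pos hq]
    · congr 2
      exact Finset.sum_congr rfl fun q hq => by
        simp only [if_pos hq]; rw [div_self hlogz0, mul_one]
  -- family S (lower) : `T = {1}`, `z_q = z`, `c_q = [q = 1]`
  have hS := hxl x hxl' {1} z (fun q => if q ∈ ({1} : Finset ℕ) then 1 else 0)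
    ⟨le_rfl, hzw⟩ ?_ ?_ ?_
  rotate_left
  · intro q; by_cases hq : q ∈ ({1} : Finset ℕ)
    · rw [if_pos hq]; exact ⟨zero_le_one, le_rfl⟩
    · rw [if_neg hq]; exact ⟨le_rfl, zero_le_one⟩
  · intro q hq; rw [if_neg hq]
  · intro q hq
    rw [Finset.mem_singleton] at hq
    subst hq
    exact ⟨le_rfl, by exact_mod_cast h1v, Nat.coprime_one_left _⟩
  have hS' : V * (f (16 / 3) - Cl * ε) ≤ S₁ := by
    have e : Real.log (x ^ (16 / 15 : ℝ) / ((1 : ℕ) : ℝ)) / Real.log z = 16 / 3 := by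
      rw [Nat.cast_one, div_one, Real.log_rpow hx0, hlogz]; field_simp; ring
    refine le_of_eq_of_le ?_ (hS.trans (le_of_eq ?_))
    · congr 2
      rw [Finset.sum_singleton, if_pos (Finset.mem_singleton_self 1), rho_one, e,
        div_self hlogz0]
      simp
    · rw [Finset.sum_singleton, if_pos (Finset.mem_singleton_self 1), one_mul]
  -- split `U₂` and combine
  rw [sum_primesIn_split hwv hvx] at h3
  have hU1 : ∑ p ∈ P₁, ((1 - 2 * Real.log p / Real.log x) * (siftedCount x p p : ℝ) +
      Real.log p / Real.log x * (siftedCount x p z : ℝ)) = UA + UB := Finset.sum_add_distrib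
  rw [hU1] at h3
  rw [h3]
  have hA'' : UA ≤ V * (MA + Cu' * ε) :=
    hA'.trans (mul_le_mul_of_nonneg_left (by gcongr; exact le_max_left _ _) hV0)
  have hB'' : UB ≤ V * (MB + Cu' * ε) :=
    hB'.trans (mul_le_mul_of_nonneg_left (by gcongr; exact le_max_left _ _) hV0)
  have hC2'' : U2 ≤ V * (M2 + Cu' * ε) :=
    hC2'.trans (mul_le_mul_of_nonneg_left (by gcongr; exact le_max_left _ _) hV0)
  have hS'' : V * (f (16 / 3) - Cl' * ε) ≤ S₁ :=
    le_trans (mul_le_mul_of_nonneg_left (by gcongr; exact le_max_left _ _) hV0) hS'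
  have hCu0 : 0 ≤ Cu' := le_max_right _ _
  have hCl0 : 0 ≤ Cl' := le_max_right _ _
  have hS1nonneg : 0 ≤ S₁ := Nat.cast_nonneg _
  have h14 : 0 ≤ 1 - 4 * ε := by linarith
  -- main chain (all steps linear in the monomials)
  have h2 : (1 - 4 * ε) * (V * (f (16 / 3) - Cl' * ε)) ≤ (1 - 4 * ε) * S₁ :=
    mul_le_mul_of_nonneg_left hS'' h14
  have h3 : ε * V * f (16 / 3) ≤ ε * V * |f (16 / 3)| :=
    mul_le_mul_of_nonneg_left (le_abs_self _) (mul_nonneg hε.le hV0)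
  have h4 : 0 ≤ ε * ε * (V * Cl') := mul_nonneg (mul_nonneg hε.le hε.le) (mul_nonneg hV0 hCl0)
  have h5 : 0 ≤ V * |f (16 / 3)| := mul_nonneg hV0 (abs_nonneg _)
  linarith [htail, hA'', hB'', hC2'', h2, h3, h4, h5, hD]

/-- **§6 assembled from Prop. 2 (without the double sum) — PROVED.**  For `0 < ε ≤ 1/4` and
`x ≥ x₀(ε)`, with `z = x^{1/5}`, `y = x^{16/15}`, `L = log x`:
`W(𝒜, z) ≥ V(z) x {f(16/3) − Σ_A − Σ_B − Σ₂ − C ε}` where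
`Σ_A = ∑_{z ≤ p < x^{1/2}} (1 − 2 log p/L)(ρ(p)/p) F(log(y/p)/log p)(log z/log p)`,
`Σ_B = ∑_{z ≤ p < x^{1/2}} (log p/L)(ρ(p)/p) F(log(y/p)/log z)`,
`Σ₂ = ∑_{x^{1/2} ≤ p < x^{1−ε}} (1 − log p/L)(ρ(p)/p) F(log(y/p)/log z)`
(the double sum of (3) is dropped, being nonnegative; the range `x^{1−ε} ≤ p < x` of (22) is
absorbed by `sum_siftedCount_le_four_mul`). [cite: IwaniecInventiones1978, §6 pp. 186–187] -/
theorem weightedSum_ge_of_prop2 (h2u : proposition2_upper) (h2l : proposition2_lower)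
    {F f : ℝ → ℝ} (hFf : IsLinearSieveFunctions F f) :
    ∃ C : ℝ, ∀ ε : ℝ, 0 < ε → ε ≤ 1 / 4 → ∃ x₀ : ℝ, ∀ x : ℝ, x₀ ≤ x →
      densityProd (x ^ (1 / 5 : ℝ)) * x *
        (f (16 / 3)
          - ∑ p ∈ primesIn (x ^ (1 / 5 : ℝ)) (x ^ (1 / 2 : ℝ)),
              (1 - 2 * Real.log p / Real.log x) * (rho p : ℝ) / p *
                F (Real.log (x ^ (16 / 15 : ℝ) / p) / Real.log p) *
                  (Real.log (x ^ (1 / 5 : ℝ)) / Real.log p)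
          - ∑ p ∈ primesIn (x ^ (1 / 5 : ℝ)) (x ^ (1 / 2 : ℝ)),
              Real.log p / Real.log x * (rho p : ℝ) / p *
                F (Real.log (x ^ (16 / 15 : ℝ) / p) / Real.log (x ^ (1 / 5 : ℝ)))
          - ∑ p ∈ primesIn (x ^ (1 / 2 : ℝ)) (x ^ (1 - ε)),
              (1 - Real.log p / Real.log x) * (rho p : ℝ) / p *
                F (Real.log (x ^ (16 / 15 : ℝ) / p) / Real.log (x ^ (1 / 5 : ℝ)))
          - C * ε) ≤
        weightedSum x (x ^ (1 / 5 : ℝ)) :=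
  weightedSum_ge_of_prop2_const h2u h2l.const hFf

end Assembly

/-! ### Partial summation against `log log`: prime sums → integrals (p. 186) -/
section Limits
open MeasureTheory intervalIntegral

/-- Partial sums `A(t) = ∑_{k ≤ t} c k` (the summatory function of Abel summation). [folklore] -/
def psum (c : ℕ → ℝ) (t : ℝ) : ℝ := ∑ k ∈ Finset.Icc 0 ⌊t⌋₊, c k

/-- The image of `[α, β]` under `u ↦ x^u` is `[x^α, x^β]` for `x > 1`. [folklore] -/
theorem image_rpow_Icc {x α β : ℝ} (hx : 1 < x) (hαβ : α ≤ β) :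
    (fun u : ℝ => x ^ u) '' Set.Icc α β = Set.Icc (x ^ α) (x ^ β) := by
  have hx0 : 0 < x := by linarith
  have hmono : StrictMono fun u : ℝ => x ^ u := fun u v huv =>
    Real.rpow_lt_rpow_of_exponent_lt hx huv
  have hcont : Continuous fun u : ℝ => x ^ u := Real.continuous_const_rpow hx0.ne'
  apply Set.Subset.antisymm
  · rintro _ ⟨u, hu, rfl⟩
    exact ⟨hmono.monotone hu.1, hmono.monotone hu.2⟩
  · intro t ht
    have := intermediate_value_Icc hαβ hcont.continuousOn
    exact this ht

/-- **Quantitative Abel summation against `log log`.**  If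
`A(t) = ∑_{k ≤ t} c_k = log log t + b₀ + E(t)`
for `t > 1`, `g` is `C¹` on `[α, β]` (`0 < α ≤ β`), `x > 1` and `|E(t)| ≤ δ` on `[x^α, x^β]`, then
`|∑_{x^α < k ≤ x^β} c_k g(log k / log x) − ∫_α^β g(u) du/u| ≤ (|g(α)| + |g(β)| + ∫_α^β |g'|) δ`
(cf. arXiv:1910.02885 Lemma 15). [folklore] -/
theorem abs_sum_mul_sub_integral_le {c : ℕ → ℝ} {b₀ : ℝ} {E : ℝ → ℝ}
    (hE : ∀ t : ℝ, 1 < t → psum c t = Real.log (Real.log t) + b₀ + E t)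
    {x α β : ℝ} (hx : 1 < x) (hα : 0 < α) (hαβ : α ≤ β)
    {g g' : ℝ → ℝ} (hg : ∀ u ∈ Set.Icc α β, HasDerivAt g (g' u) u)
    (hg' : ContinuousOn g' (Set.Icc α β))
    {δ : ℝ} (hδ : ∀ t : ℝ, x ^ α ≤ t → t ≤ x ^ β → |E t| ≤ δ) :
    |∑ k ∈ Finset.Ioc ⌊x ^ α⌋₊ ⌊x ^ β⌋₊, g (Real.log k / Real.log x) * c k -
        ∫ u in α..β, g u / u| ≤ (|g α| + |g β| + ∫ u in α..β, |g' u|) * δ := by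
  -- notation
  set L := Real.log x with hL
  have hL0 : 0 < L := Real.log_pos hx
  have hx0 : 0 < x := by linarith
  set a := x ^ α with ha
  set b := x ^ β with hb
  have ha1 : 1 < a := Real.one_lt_rpow hx hα
  have hab : a ≤ b := Real.rpow_le_rpow_of_exponent_le hx.le hαβ
  have ha0 : 0 < a := by linarith
  have hδ0 : 0 ≤ δ := (abs_nonneg _).trans (hδ a le_rfl hab)
  -- `u(t) = log t / L` maps `[a, b]` onto `[α, β]`
  have hu_mem : ∀ t ∈ Set.Icc a b, Real.log t / L ∈ Set.Icc α β := by
    intro t ht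
    have ht0 : 0 < t := by linarith [ht.1]
    constructor
    · rw [le_div_iff₀ hL0, ← Real.log_rpow hx0]; exact Real.log_le_log ha0 ht.1
    · rw [div_le_iff₀ hL0, ← Real.log_rpow hx0]; exact Real.log_le_log ht0 ht.2
  have hua : Real.log a / L = α := by rw [ha, Real.log_rpow hx0, ← hL]; field_simp
  have hub : Real.log b / L = β := by rw [hb, Real.log_rpow hx0, ← hL]; field_simp
  -- `f(t) = g(log t / L)` and its derivative
  set f : ℝ → ℝ := fun t => g (Real.log t / L) with hf
  set f' : ℝ → ℝ := fun t => g' (Real.log t / L) * (t⁻¹ / L) with hf'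
  have hfd : ∀ t ∈ Set.Icc a b, HasDerivAt f (f' t) t := by
    intro t ht
    have ht0 : (t : ℝ) ≠ 0 := by linarith [ht.1]
    have h1 : HasDerivAt (fun t : ℝ => Real.log t / L) (t⁻¹ / L) t :=
      (Real.hasDerivAt_log ht0).div_const L
    exact (hg _ (hu_mem t ht)).comp t h1
  have hgc : ContinuousOn g (Set.Icc α β) := fun u hu => (hg u hu).continuousAt.continuousWithinAt
  have hmem0 : ∀ t ∈ Set.Icc a b, t ∈ ({0}ᶜ : Set ℝ) := fun t ht =>
    Set.mem_compl_singleton_iff.mpr (by linarith [ht.1] : (0 : ℝ) < t).ne'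
  have hlogc : ContinuousOn (fun t : ℝ => Real.log t / L) (Set.Icc a b) :=
    (Real.continuousOn_log.mono hmem0).div_const L
  have hfc : ContinuousOn f (Set.Icc a b) := hgc.comp hlogc hu_mem
  have hf'c : ContinuousOn f' (Set.Icc a b) :=
    (hg'.comp hlogc hu_mem).mul ((continuousOn_inv₀.mono hmem0).div_const L)
  -- Abel summation
  have hderiv : ∀ t ∈ Set.Icc a b, deriv f t = f' t := fun t ht => (hfd t ht).deriv
  have hf'int : IntegrableOn f' (Set.Icc a b) := hf'c.integrableOn_Icc
  have hAbel := sum_mul_eq_sub_sub_integral_mul c ha0.le hab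
    (fun t ht => (hfd t ht).differentiableAt)
    (hf'int.congr_fun (fun t ht => (hderiv t ht).symm) measurableSet_Icc)
  -- rewrite the integral with `f'` and over `a..b`
  have hIoc : ∫ t in Set.Ioc a b, deriv f t * psum c t = ∫ t in a..b, f' t * psum c t := by
    rw [intervalIntegral.integral_of_le hab]
    refine setIntegral_congr_fun measurableSet_Ioc fun t ht => ?_
    rw [hderiv t ⟨ht.1.le, ht.2⟩]
  change ∑ k ∈ Finset.Ioc ⌊a⌋₊ ⌊b⌋₊, f k * c k =
    f b * psum c b - f a * psum c a - ∫ t in Set.Ioc a b, deriv f t * psum c t at hAbel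
  rw [hIoc] at hAbel
  -- the smooth part `ℓ(t) = log log t + b₀`
  set ℓ : ℝ → ℝ := fun t => Real.log (Real.log t) + b₀ with hℓ
  set ℓ' : ℝ → ℝ := fun t => t⁻¹ / Real.log t with hℓ'
  have hℓd : ∀ t ∈ Set.Icc a b, HasDerivAt ℓ (ℓ' t) t := by
    intro t ht
    have ht1 : 1 < t := by linarith [ht.1]
    have h1 := ((Real.hasDerivAt_log (by linarith : t ≠ 0)).log (Real.log_pos ht1).ne').add_const b₀
    show HasDerivAt (fun t => Real.log (Real.log t) + b₀) (t⁻¹ / Real.log t) t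
    exact h1
  have hℓ'c : ContinuousOn ℓ' (Set.Icc a b) :=
    (continuousOn_inv₀.mono hmem0).div (Real.continuousOn_log.mono hmem0)
      fun t ht => (Real.log_pos (by linarith [ht.1])).ne'
  have hℓc : ContinuousOn ℓ (Set.Icc a b) := fun t ht => (hℓd t ht).continuousAt.continuousWithinAt
  -- decomposition of `psum` on `[a, b]`
  have hpsum : ∀ t ∈ Set.Icc a b, psum c t = ℓ t + E t := fun t ht => by
    rw [hE t (by linarith [ht.1])]
  -- integration by parts: `∫ (f' ℓ + f ℓ') = f b ℓ b − f a ℓ a`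
  have huIcc : Set.uIcc a b = Set.Icc a b := Set.uIcc_of_le hab
  have hparts := intervalIntegral.integral_deriv_mul_eq_sub (a := a) (b := b) (u := f) (v := ℓ)
    (u' := f') (v' := ℓ') (fun t ht => hfd t (huIcc ▸ ht)) (fun t ht => hℓd t (huIcc ▸ ht))
    ((hf'c.mono (by rw [huIcc])).intervalIntegrable)
    ((hℓ'c.mono (by rw [huIcc])).intervalIntegrable)
  -- substitution: `∫_a^b f ℓ' = ∫_α^β g(u)/u du` and `∫_a^b |f'| = ∫_α^β |g'|`
  have hsubst : ∀ (G : ℝ → ℝ), ContinuousOn G (Set.Icc α β) →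
      ∫ t in a..b, G (Real.log t / L) * (t⁻¹ / L) = ∫ u in α..β, G u := by
    intro G hG
    have h := intervalIntegral.integral_comp_mul_deriv' (a := a) (b := b)
      (f := fun t : ℝ => Real.log t / L) (f' := fun t => t⁻¹ / L) (g := G)
      (fun t ht => (Real.hasDerivAt_log
        ((by rw [huIcc] at ht; linarith [ht.1] : (0 : ℝ) < t).ne')).div_const L)
      (((continuousOn_inv₀.mono (by rw [huIcc]; exact hmem0)).div_const L))
      (hG.mono (by
        rw [huIcc]
        rintro _ ⟨t, ht, rfl⟩
        exact hu_mem t ht))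
    rw [hua, hub] at h
    rw [← h]
    rfl
  have hmain : ∫ t in a..b, f t * ℓ' t = ∫ u in α..β, g u / u := by
    have h1 : ∀ t ∈ Set.uIcc a b, f t * ℓ' t = (fun u => g u / u) (Real.log t / L) * (t⁻¹ / L) := by
      intro t ht
      rw [huIcc] at ht
      have ht1 : 1 < t := by linarith [ht.1]
      have hlt : Real.log t ≠ 0 := (Real.log_pos ht1).ne'
      have ht0 : t ≠ 0 := by linarith [ht.1]
      show g (Real.log t / L) * (t⁻¹ / Real.log t) =
        g (Real.log t / L) / (Real.log t / L) * (t⁻¹ / L)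
      field_simp
    rw [intervalIntegral.integral_congr h1]
    exact hsubst (fun u => g u / u) (hgc.div continuousOn_id fun u hu =>
      (by linarith [hu.1] : (0 : ℝ) < u).ne')
  have habs : ∫ t in a..b, |f' t| = ∫ u in α..β, |g' u| := by
    have h1 : ∀ t ∈ Set.uIcc a b, |f' t| = (fun u => |g' u|) (Real.log t / L) * (t⁻¹ / L) := by
      intro t ht
      rw [huIcc] at ht
      have : 0 ≤ t⁻¹ / L := div_nonneg (inv_nonneg.mpr (by linarith [ht.1])) hL0.le
      show |g' (Real.log t / L) * (t⁻¹ / L)| = |g' (Real.log t / L)| * (t⁻¹ / L)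
      rw [abs_mul, abs_of_nonneg this]
    rw [intervalIntegral.integral_congr h1]
    exact hsubst (fun u => |g' u|) (continuous_abs.comp_continuousOn hg')
  -- assemble: the sum equals `∫ g/u + [f b E b − f a E a − ∫ f' E]`
  have hfa : f a = g α := by simp only [hf, hua]
  have hfb : f b = g β := by simp only [hf, hub]
  -- integrability facts on `a..b`
  have hi1 : IntervalIntegrable (fun t => f' t * psum c t) volume a b := by
    rw [intervalIntegrable_iff_integrableOn_Icc_of_le hab]
    exact integrableOn_mul_sum_Icc c ha0.le hf'int
  have hi2 : IntervalIntegrable (fun t => f' t * ℓ t) volume a b :=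
    ((hf'c.mul hℓc).mono (by rw [huIcc])).intervalIntegrable
  have hi3 : IntervalIntegrable (fun t => f t * ℓ' t) volume a b :=
    ((hfc.mul hℓ'c).mono (by rw [huIcc])).intervalIntegrable
  have hi4 : IntervalIntegrable (fun t => |f' t|) volume a b :=
    ((continuous_abs.comp_continuousOn hf'c).mono (by rw [huIcc])).intervalIntegrable
  -- `∫ f' psum = ∫ f' ℓ + ∫ f' E` where the last is defined as a difference
  have hsplit : ∫ t in a..b, f' t * psum c t =
      (∫ t in a..b, f' t * ℓ t) + ∫ t in a..b, (f' t * psum c t - f' t * ℓ t) := by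
    rw [intervalIntegral.integral_sub hi1 hi2]; ring
  have hparts' : ∫ t in a..b, f' t * ℓ t = f b * ℓ b - f a * ℓ a - ∫ t in a..b, f t * ℓ' t := by
    rw [← hparts, intervalIntegral.integral_add hi2 hi3]; ring
  -- the error integral is bounded by `δ ∫ |f'|`
  have herr : |∫ t in a..b, (f' t * psum c t - f' t * ℓ t)| ≤ δ * ∫ t in a..b, |f' t| := by
    rw [← intervalIntegral.integral_const_mul]
    have hle : ∀ t ∈ Set.Ioc a b, |f' t * psum c t - f' t * ℓ t| ≤ δ * |f' t| := by
      intro t ht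
      rw [hpsum t ⟨ht.1.le, ht.2⟩, show f' t * (ℓ t + E t) - f' t * ℓ t = f' t * E t by ring,
        abs_mul, mul_comm]
      exact mul_le_mul_of_nonneg_right (hδ t ht.1.le ht.2) (abs_nonneg _)
    rw [intervalIntegral.integral_of_le hab, intervalIntegral.integral_of_le hab]
    refine (Real.norm_eq_abs _ ▸ norm_integral_le_of_norm_le ((hi4.const_mul δ).1 |>.mono_set
      le_rfl) ?_)
    · rw [ae_restrict_iff' measurableSet_Ioc]
      exact Eventually.of_forall fun t ht => by rw [Real.norm_eq_abs]; exact hle t ht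
  -- final computation
  have hEa : |E a| ≤ δ := hδ a le_rfl hab
  have hEb : |E b| ≤ δ := hδ b hab le_rfl
  have hint_nonneg : 0 ≤ ∫ u in α..β, |g' u| :=
    intervalIntegral.integral_nonneg hαβ fun u _ => abs_nonneg _
  have key : ∑ k ∈ Finset.Ioc ⌊a⌋₊ ⌊b⌋₊, f k * c k - ∫ u in α..β, g u / u =
      f b * E b - f a * E a - ∫ t in a..b, (f' t * psum c t - f' t * ℓ t) := by
    rw [hAbel, hsplit, hparts', hmain, hpsum a ⟨le_rfl, hab⟩, hpsum b ⟨hab, le_rfl⟩]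
    ring
  rw [key, hfa, hfb]
  calc |g β * E b - g α * E a - ∫ t in a..b, (f' t * psum c t - f' t * ℓ t)|
      ≤ |g β * E b - g α * E a| + |∫ t in a..b, (f' t * psum c t - f' t * ℓ t)| := abs_sub _ _
    _ ≤ |g β * E b| + |g α * E a| + |∫ t in a..b, (f' t * psum c t - f' t * ℓ t)| := by
        gcongr; exact abs_sub _ _
    _ ≤ |g β| * δ + |g α| * δ + δ * ∫ t in a..b, |f' t| := by
        rw [abs_mul, abs_mul]
        gcongr
    _ = (|g α| + |g β| + ∫ u in α..β, |g' u|) * δ := by rw [habs]; ring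


open Polynomial in
/-- `ρ(p) ≤ 2` for a prime `p`: the roots of `X² + 1` in the field `ZMod p`. [folklore] -/
theorem rho_le_two {p : ℕ} (hp : p.Prime) : rho p ≤ 2 := by
  haveI := Fact.mk hp
  unfold rho
  set S := (Finset.range p).filter fun ν : ℕ => p ∣ ν ^ 2 + 1 with hS
  -- inject into the roots of `X^2 + 1 : (ZMod p)[X]`
  set P : (ZMod p)[X] := X ^ 2 + 1 with hP
  have hP0 : P ≠ 0 := by
    have hdeg : P.natDegree = 2 := by
      rw [hP]; compute_degree!
    intro h; rw [h, natDegree_zero] at hdeg; exact absurd hdeg (by norm_num)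
  have hdeg : P.natDegree = 2 := by rw [hP]; compute_degree!
  have hmaps : ∀ ν ∈ S, ((ν : ZMod p)) ∈ P.roots.toFinset := by
    intro ν hν
    rw [Multiset.mem_toFinset, mem_roots hP0, IsRoot, hP]
    simp only [eval_add, eval_pow, eval_X, eval_one]
    have hd := (Finset.mem_filter.mp hν).2
    have : ((ν ^ 2 + 1 : ℕ) : ZMod p) = 0 := (ZMod.natCast_eq_zero_iff _ _).mpr hd
    push_cast at this
    exact this
  have hinj : Set.InjOn (fun ν : ℕ => (ν : ZMod p)) S := by
    intro a ha b hb hab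
    have ha' := Finset.mem_range.mp (Finset.mem_filter.mp ha).1
    have hb' := Finset.mem_range.mp (Finset.mem_filter.mp hb).1
    have := (ZMod.natCast_eq_natCast_iff' a b p).mp hab
    rwa [Nat.mod_eq_of_lt ha', Nat.mod_eq_of_lt hb'] at this
  calc S.card ≤ P.roots.toFinset.card := Finset.card_le_card_of_injOn _ hmaps hinj
    _ ≤ Multiset.card P.roots := Multiset.toFinset_card_le _
    _ ≤ P.natDegree := card_roots' P
    _ = 2 := hdeg


/-- The weight `ρ(k)/k` on primes (`0` elsewhere). [folklore] -/
def rhoWeight (k : ℕ) : ℝ := if k.Prime then (rho k : ℝ) / k else 0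

/-- `ρ(k)[k prime]/k ≥ 0`. [folklore] -/
theorem rhoWeight_nonneg (k : ℕ) : 0 ≤ rhoWeight k := by
  unfold rhoWeight; split_ifs <;> positivity

/-- `ρ(k)[k prime]/k ≤ 2/k`. [folklore] -/
theorem rhoWeight_le (k : ℕ) : rhoWeight k ≤ 2 / k := by
  unfold rhoWeight
  split_ifs with h
  · exact div_le_div_of_nonneg_right (by exact_mod_cast rho_le_two h) (Nat.cast_nonneg _)
  · positivity

/-- The partial sums of `rhoWeight` are `∑_{p ≤ t} ρ(p)/p`. [folklore] -/
theorem psum_rhoWeight (t : ℝ) :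
    psum rhoWeight t = ∑ p ∈ Nat.primesLE ⌊t⌋₊, (rho p : ℝ) / p := by
  rw [psum, Nat.primesLE, Nat.primesBelow, Finset.sum_filter, Finset.range_eq_Ico,
    ← Finset.Ico_succ_right_eq_Icc]
  rfl

/-- Hypothesis packaging: `∑_{p ≤ t} ρ(p)/p − log log t` converges (discharged below by
`tendsto_sum_primesLE_rho_div_sub_loglog`). [folklore] -/
def RhoMertens : Prop :=
  ∃ b : ℝ, Tendsto (fun t : ℝ => ∑ p ∈ Nat.primesLE ⌊t⌋₊, (rho p : ℝ) / p - Real.log (Real.log t))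
    atTop (𝓝 b)

/-- **Prime sums → integrals (limit form).** Under `RhoMertens`, for `g ∈ C¹[α, β]`, `0 < α ≤ β`:
`∑_{x^α < k ≤ x^β} g(log k/log x) ρ(k)[k prime]/k → ∫_α^β g(u) du/u` (p. 186, "if we replace sums by
integrals, as we can do by partial summation"; arXiv:1910.02885 Lemmas 14–15).
[cite: IwaniecInventiones1978, §6 p. 186] -/
theorem tendsto_sum_Ioc_rhoWeight (hP : RhoMertens) {α β : ℝ} (hα : 0 < α) (hαβ : α ≤ β)
    {g g' : ℝ → ℝ} (hg : ∀ u ∈ Set.Icc α β, HasDerivAt g (g' u) u)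
    (hg' : ContinuousOn g' (Set.Icc α β)) :
    Tendsto (fun x : ℝ => ∑ k ∈ Finset.Ioc ⌊x ^ α⌋₊ ⌊x ^ β⌋₊,
        g (Real.log k / Real.log x) * rhoWeight k) atTop (𝓝 (∫ u in α..β, g u / u)) := by
  obtain ⟨b, hb⟩ := hP
  set E : ℝ → ℝ := fun t => psum rhoWeight t - Real.log (Real.log t) - b with hEdef
  have hE : ∀ t : ℝ, 1 < t → psum rhoWeight t = Real.log (Real.log t) + b + E t :=
    fun t _ => by simp only [hEdef]; ring
  have hE0 : Tendsto E atTop (𝓝 0) := by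
    have h1 := hb.sub_const b
    rw [sub_self] at h1
    refine h1.congr' (Eventually.of_forall fun t => ?_)
    simp only [hEdef, psum_rhoWeight]
  set K := |g α| + |g β| + ∫ u in α..β, |g' u| with hK
  have hK0 : 0 ≤ K := by
    have : 0 ≤ ∫ u in α..β, |g' u| := intervalIntegral.integral_nonneg hαβ fun u _ => abs_nonneg _
    positivity
  rw [Metric.tendsto_nhds]
  intro δ hδ
  have hδ' : 0 < δ / (K + 1) := by positivity
  obtain ⟨T₀, hT₀⟩ := (Metric.tendsto_atTop.mp hE0) (δ / (K + 1)) hδ'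
  filter_upwards [eventually_gt_atTop (1 : ℝ), (tendsto_rpow_atTop hα).eventually_ge_atTop T₀]
    with x hx1 hxT
  have hbound := abs_sum_mul_sub_integral_le (c := rhoWeight) hE hx1 hα hαβ hg hg'
    (δ := δ / (K + 1)) (fun t ht _ => by
      have := hT₀ t (hxT.trans ht)
      rw [Real.dist_eq, sub_zero] at this
      exact this.le)
  rw [Real.dist_eq]
  calc |∑ k ∈ Finset.Ioc ⌊x ^ α⌋₊ ⌊x ^ β⌋₊, g (Real.log k / Real.log x) * rhoWeight k -
        ∫ u in α..β, g u / u| ≤ K * (δ / (K + 1)) := hbound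
    _ < δ := by
      rw [mul_div_assoc']
      rw [div_lt_iff₀ (by positivity)]
      nlinarith

/-- **Endpoint comparison.** For `0 < A ≤ B` and `h ≥ 0` on `(⌊A⌋, ⌊B⌋]`, bounded by `H` on the
primes of `[A, B)`: `∑_{A ≤ p < B} (ρ(p)/p) h(p) ≤ ∑_{A < k ≤ B} ρ(k)[k prime]/k · h(k) + 2H/A`.
[folklore] -/
theorem sum_primesIn_le_sum_Ioc {A B : ℝ} (hA : 0 < A) {h : ℕ → ℝ} {H : ℝ} (hH : 0 ≤ H)
    (hh0 : ∀ k ∈ Finset.Ioc ⌊A⌋₊ ⌊B⌋₊, 0 ≤ h k) (hhH : ∀ p ∈ primesIn A B, h p ≤ H) :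
    ∑ p ∈ primesIn A B, (rho p : ℝ) / p * h p ≤
      ∑ k ∈ Finset.Ioc ⌊A⌋₊ ⌊B⌋₊, rhoWeight k * h k + 2 * H / A := by
  rw [← Finset.sum_filter_add_sum_filter_not (primesIn A B) (fun p : ℕ => A < (p : ℝ))]
  refine add_le_add ?_ ?_
  · -- the part with `A < p` sits inside `Ioc ⌊A⌋ ⌊B⌋`
    have hsub : (primesIn A B).filter (fun p : ℕ => A < (p : ℝ)) ⊆ Finset.Ioc ⌊A⌋₊ ⌊B⌋₊ := by
      intro p hp
      rw [Finset.mem_filter, mem_primesIn] at hp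
      rw [Finset.mem_Ioc]
      exact ⟨(Nat.floor_lt hA.le).mpr hp.2, Nat.le_floor hp.1.2.2.le⟩
    have heq : ∀ p ∈ (primesIn A B).filter (fun p : ℕ => A < (p : ℝ)),
        (rho p : ℝ) / p * h p = rhoWeight p * h p := by
      intro p hp
      rw [Finset.mem_filter, mem_primesIn] at hp
      rw [rhoWeight, if_pos hp.1.1]
    rw [Finset.sum_congr rfl heq]
    exact Finset.sum_le_sum_of_subset_of_nonneg hsub fun k hk _ =>
      mul_nonneg (rhoWeight_nonneg k) (hh0 k hk)
  · -- the possible endpoint `p = A`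
    have hsub : (primesIn A B).filter (fun p : ℕ => ¬ A < (p : ℝ)) ⊆ {⌊A⌋₊} := by
      intro p hp
      rw [Finset.mem_filter, mem_primesIn, not_lt] at hp
      rw [Finset.mem_singleton]
      have : (p : ℝ) = A := le_antisymm hp.2 hp.1.2.1
      rw [← this, Nat.floor_natCast]
    calc ∑ p ∈ (primesIn A B).filter (fun p : ℕ => ¬ A < (p : ℝ)), (rho p : ℝ) / p * h p
        ≤ ∑ p ∈ ({⌊A⌋₊} : Finset ℕ), (if p ∈ (primesIn A B).filter (fun p : ℕ => ¬ A < (p : ℝ))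
            then (rho p : ℝ) / p * h p else 0) := by
          rw [← Finset.sum_filter, Finset.filter_mem_eq_inter, Finset.inter_eq_right.mpr hsub]
      _ ≤ 2 * H / A := by
          rw [Finset.sum_singleton]
          split_ifs with hmem
          · rw [Finset.mem_filter, mem_primesIn, not_lt] at hmem
            have hpA : ((⌊A⌋₊ : ℕ) : ℝ) = A := le_antisymm hmem.2 hmem.1.2.1
            have hprime := hmem.1.1
            have hρ : (rho ⌊A⌋₊ : ℝ) ≤ 2 := by exact_mod_cast rho_le_two hprime
            have hhp : h ⌊A⌋₊ ≤ H := hhH _ (mem_primesIn.mpr hmem.1)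
            have hh0' : 0 ≤ h ⌊A⌋₊ ∨ h ⌊A⌋₊ < 0 := le_or_gt 0 _
            rw [hpA]
            rcases hh0' with h0 | h0
            · calc (rho ⌊A⌋₊ : ℝ) / A * h ⌊A⌋₊ ≤ 2 / A * H := by gcongr
                _ = 2 * H / A := by ring
            · calc (rho ⌊A⌋₊ : ℝ) / A * h ⌊A⌋₊ ≤ 0 :=
                    mul_nonpos_of_nonneg_of_nonpos (by positivity) h0.le
                _ ≤ 2 * H / A := by positivity
          · positivity

/-! #### The weight `g_B(u) = u F((α − u)/γ)` and the bound for `M_B` -/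

/-- `F ≥ 0` on `(0, 5]` (from the explicit formulas of p. 187).
[cite: IwaniecInventiones1978, §6 p. 187] -/
theorem IsLinearSieveFunctions.upper_nonneg {F f : ℝ → ℝ} (h : IsLinearSieveFunctions F f)
    {s : ℝ} (hs0 : 0 < s) (hs5 : s ≤ 5) : 0 ≤ F s := by
  rcases le_or_gt s 3 with hs3 | hs3
  · rw [h.upper_eq_div hs0 hs3]; exact div_nonneg (by unfold sieveA; positivity) hs0.le
  · rw [h.upper_eq_logInt_div hs3.le hs5]
    refine div_nonneg (mul_nonneg (by unfold sieveA; positivity) ?_) hs0.le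
    have : 0 ≤ logInt (s - 1) := by
      unfold logInt
      refine intervalIntegral.integral_nonneg (by linarith) fun u hu => ?_
      exact div_nonneg (Real.log_nonneg (by linarith [hu.1])) (by linarith [hu.1])
    linarith

/-- Chain rule for `F ∘ φ`. [folklore] -/
theorem IsLinearSieveFunctions.hasDerivAt_upper_comp {F f : ℝ → ℝ} (h : IsLinearSieveFunctions F f)
    {φ : ℝ → ℝ} {φ' u : ℝ} (hφ : HasDerivAt φ φ' u) (hpos : 0 < φ u) :
    HasDerivAt (fun v => F (φ v))
      ((IsLinearSieveFunctions.mulUpperDeriv f (φ u) - F (φ u)) / φ u * φ') u :=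
  (h.hasDerivAt_upper' hpos).comp u hφ

/-- The `M_B` weight `g_B(u) = u F(5(16/15 − u))` is `C¹` on `[1/5, 1/2]`: derivative. [folklore] -/
theorem hasDerivAt_gB {F f : ℝ → ℝ} (h : IsLinearSieveFunctions F f) {u : ℝ} (hu : u < 16 / 15) :
    HasDerivAt (fun v : ℝ => v * F (5 * (16 / 15 - v)))
      (F (5 * (16 / 15 - u)) + u *
        ((IsLinearSieveFunctions.mulUpperDeriv f (5 * (16 / 15 - u)) - F (5 * (16 / 15 - u))) /
          (5 * (16 / 15 - u)) * (-5))) u := by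
  have hφ : HasDerivAt (fun v : ℝ => 5 * (16 / 15 - v)) (-5) u := by
    have h1 := ((hasDerivAt_id u).const_sub (16 / 15 : ℝ)).const_mul (5 : ℝ)
    refine h1.congr_deriv ?_
    norm_num
  have hF := h.hasDerivAt_upper_comp hφ (by linarith : 0 < 5 * (16 / 15 - u))
  have h2 := HasDerivAt.mul (hasDerivAt_id' u) hF
  refine h2.congr_deriv ?_
  ring

/-- Continuity of `g_B'` below `16/15`. [folklore] -/
theorem continuousOn_gB_deriv {F f : ℝ → ℝ} (h : IsLinearSieveFunctions F f) :
    ContinuousOn (fun u : ℝ => F (5 * (16 / 15 - u)) + u *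
        ((IsLinearSieveFunctions.mulUpperDeriv f (5 * (16 / 15 - u)) - F (5 * (16 / 15 - u))) /
          (5 * (16 / 15 - u)) * (-5))) (Set.Iio (16 / 15)) := by
  have hφc : Continuous fun u : ℝ => 5 * (16 / 15 - u) := by continuity
  have hmaps : Set.MapsTo (fun u : ℝ => 5 * (16 / 15 - u)) (Set.Iio (16 / 15)) (Set.Ioi 0) := by
    intro u hu; simp only [Set.mem_Iio] at hu; simp only [Set.mem_Ioi]; linarith
  have hF : ContinuousOn (fun u : ℝ => F (5 * (16 / 15 - u))) (Set.Iio (16 / 15)) :=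
    h.continuousOn_upper.comp hφc.continuousOn hmaps
  have hF' : ContinuousOn (fun u : ℝ =>
      (IsLinearSieveFunctions.mulUpperDeriv f (5 * (16 / 15 - u)) - F (5 * (16 / 15 - u))) /
        (5 * (16 / 15 - u))) (Set.Iio (16 / 15)) :=
    (IsLinearSieveFunctions.continuousOn_upperDeriv h).comp hφc.continuousOn hmaps
  exact hF.add (continuousOn_id.mul (hF'.mul continuousOn_const))

/-- **Bound for `M_B`:** under `RhoMertens`, for every `δ > 0`, eventually
`M_B(x) ≤ ∫_{1/5}^{1/2} F(5(16/15 − u)) du + δ` (`= T4 + δ`; the term `∫ u F((α−u)/γ) du/u` of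
p. 186). [cite: IwaniecInventiones1978, §6 p. 186] -/
theorem MB_le (hP : RhoMertens) {F f : ℝ → ℝ} (h : IsLinearSieveFunctions F f) {δ : ℝ}
    (hδ : 0 < δ) :
    ∀ᶠ x : ℝ in atTop,
      ∑ p ∈ primesIn (x ^ (1 / 5 : ℝ)) (x ^ (1 / 2 : ℝ)),
          Real.log p / Real.log x * (rho p : ℝ) / p *
            F (Real.log (x ^ (16 / 15 : ℝ) / p) / Real.log (x ^ (1 / 5 : ℝ))) ≤
        (∫ u in (1 / 5 : ℝ)..(1 / 2), F (5 * (16 / 15 - u))) + δ := by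
  set gB : ℝ → ℝ := fun v => v * F (5 * (16 / 15 - v)) with hgB
  -- `C¹` data on `[1/5, 1/2]`
  have hderiv : ∀ u ∈ Set.Icc (1 / 5 : ℝ) (1 / 2), HasDerivAt gB _ u := fun u hu =>
    hasDerivAt_gB h (by linarith [hu.2])
  have hcont' := (continuousOn_gB_deriv h).mono
    (show Set.Icc (1 / 5 : ℝ) (1 / 2) ⊆ Set.Iio (16 / 15) from fun u hu => by
      simp only [Set.mem_Iio]; linarith [hu.2])
  -- a bound `H` for `|g_B|` on `[1/5, 1/2]`
  have hgBc : ContinuousOn gB (Set.Icc (1 / 5 : ℝ) (1 / 2)) :=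
    fun u hu => (hderiv u hu).continuousAt.continuousWithinAt
  obtain ⟨H, hH⟩ := isCompact_Icc.exists_bound_of_continuousOn hgBc
  have hH0 : 0 ≤ H := le_trans (norm_nonneg _) (hH (1 / 5) ⟨le_rfl, by norm_num⟩)
  -- the limit of the `Ioc`-sums
  have hlim := tendsto_sum_Ioc_rhoWeight hP (by norm_num : (0 : ℝ) < 1 / 5)
    (by norm_num : (1 / 5 : ℝ) ≤ 1 / 2) hderiv hcont'
  have hint : ∫ u in (1 / 5 : ℝ)..(1 / 2), gB u / u =
      ∫ u in (1 / 5 : ℝ)..(1 / 2), F (5 * (16 / 15 - u)) := by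
    refine intervalIntegral.integral_congr fun u hu => ?_
    rw [Set.uIcc_of_le (by norm_num : (1 / 5 : ℝ) ≤ 1 / 2)] at hu
    have hu0 : u ≠ 0 := by linarith [hu.1]
    simp only [hgB]
    rw [mul_comm, mul_div_assoc, div_self hu0, mul_one]
  rw [hint] at hlim
  have hev1 := (Metric.tendsto_nhds.mp hlim) (δ / 2) (by positivity)
  have hev2 : ∀ᶠ x : ℝ in atTop, 2 * H / x ^ (1 / 5 : ℝ) ≤ δ / 2 := by
    have ht : Tendsto (fun x : ℝ => 2 * H / x ^ (1 / 5 : ℝ)) atTop (𝓝 0) := by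
      have := (tendsto_rpow_atTop (by norm_num : (0 : ℝ) < 1 / 5)).inv_tendsto_atTop.const_mul
        (2 * H)
      simpa [div_eq_mul_inv] using this
    exact (ht.eventually (Iic_mem_nhds (by positivity : (0 : ℝ) < δ / 2))).mono fun x hx => hx
  filter_upwards [hev1, hev2, eventually_gt_atTop (1 : ℝ)] with x hx1 hx2 hx
  have hx0 : 0 < x := by linarith
  have hL0 : 0 < Real.log x := Real.log_pos hx
  have hz1 : 1 < x ^ (1 / 5 : ℝ) := Real.one_lt_rpow hx (by norm_num)
  -- rewrite the summand as `(ρ p / p) g_B(u_p)`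
  have hsum : ∑ p ∈ primesIn (x ^ (1 / 5 : ℝ)) (x ^ (1 / 2 : ℝ)),
      Real.log p / Real.log x * (rho p : ℝ) / p *
        F (Real.log (x ^ (16 / 15 : ℝ) / p) / Real.log (x ^ (1 / 5 : ℝ))) =
      ∑ p ∈ primesIn (x ^ (1 / 5 : ℝ)) (x ^ (1 / 2 : ℝ)),
        (rho p : ℝ) / p * gB (Real.log p / Real.log x) := by
    refine Finset.sum_congr rfl fun p hp => ?_
    have hpp := mem_primesIn.mp hp
    have hp0 : (0 : ℝ) < p := by exact_mod_cast hpp.1.pos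
    have e : Real.log (x ^ (16 / 15 : ℝ) / p) / Real.log (x ^ (1 / 5 : ℝ)) =
        5 * (16 / 15 - Real.log p / Real.log x) := by
      rw [Real.log_div (by positivity) hp0.ne', Real.log_rpow hx0, Real.log_rpow hx0]
      field_simp
    rw [e, hgB]
    ring
  rw [hsum]
  -- endpoint comparison
  have hcmp := sum_primesIn_le_sum_Ioc (A := x ^ (1 / 5 : ℝ)) (B := x ^ (1 / 2 : ℝ))
    (by positivity) (h := fun k : ℕ => gB (Real.log k / Real.log x)) hH0 ?_ ?_
  rotate_left
  · intro k hk
    rw [Finset.mem_Ioc] at hk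
    have hk1 : x ^ (1 / 5 : ℝ) < k := (Nat.floor_lt (by positivity)).mp hk.1
    have hk2 : (k : ℝ) ≤ x ^ (1 / 2 : ℝ) := by
      have := Nat.floor_le (show 0 ≤ x ^ (1 / 2 : ℝ) by positivity)
      exact le_trans (by exact_mod_cast hk.2) this
    have hk0 : (0 : ℝ) < k := by linarith
    have hu1 : 1 / 5 < Real.log k / Real.log x := by
      rw [lt_div_iff₀ hL0, ← Real.log_rpow hx0]; exact Real.log_lt_log (by positivity) hk1
    have hu2 : Real.log k / Real.log x ≤ 1 / 2 := by
      rw [div_le_iff₀ hL0, ← Real.log_rpow hx0]; exact Real.log_le_log hk0 hk2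
    simp only [hgB]
    exact mul_nonneg (by linarith) (h.upper_nonneg (by linarith) (by linarith))
  · intro p hp
    have hpp := mem_primesIn.mp hp
    have hp0 : (0 : ℝ) < p := by exact_mod_cast hpp.1.pos
    have hu1 : 1 / 5 ≤ Real.log p / Real.log x := by
      rw [le_div_iff₀ hL0, ← Real.log_rpow hx0]; exact Real.log_le_log (by positivity) hpp.2.1
    have hu2 : Real.log p / Real.log x ≤ 1 / 2 := by
      rw [div_le_iff₀ hL0, ← Real.log_rpow hx0]; exact Real.log_le_log hp0 hpp.2.2.le
    have := hH _ ⟨hu1, hu2⟩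
    rw [Real.norm_eq_abs] at this
    exact (le_abs_self _).trans this
  -- combine
  have hIoc : ∑ k ∈ Finset.Ioc ⌊x ^ (1 / 5 : ℝ)⌋₊ ⌊x ^ (1 / 2 : ℝ)⌋₊,
      rhoWeight k * gB (Real.log k / Real.log x) ≤
      (∫ u in (1 / 5 : ℝ)..(1 / 2), F (5 * (16 / 15 - u))) + δ / 2 := by
    have := hx1
    rw [Real.dist_eq] at this
    have h' : ∑ k ∈ Finset.Ioc ⌊x ^ (1 / 5 : ℝ)⌋₊ ⌊x ^ (1 / 2 : ℝ)⌋₊,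
        rhoWeight k * gB (Real.log k / Real.log x) =
        ∑ k ∈ Finset.Ioc ⌊x ^ (1 / 5 : ℝ)⌋₊ ⌊x ^ (1 / 2 : ℝ)⌋₊,
          gB (Real.log k / Real.log x) * rhoWeight k := Finset.sum_congr rfl fun k _ => mul_comm _ _
    rw [h']
    linarith [(abs_lt.mp this).2]
  linarith [hcmp, hIoc, hx2]

/-! #### The weight `g_2(u) = (1 − u) F(5(16/15 − u))` and the bound for `M_2` -/

/-- Derivative of the weight `g₂(u) = (1 − u) F(5(16/15 − u))`. [folklore] -/
theorem hasDerivAt_g2 {F f : ℝ → ℝ} (h : IsLinearSieveFunctions F f) {u : ℝ} (hu : u < 16 / 15) :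
    HasDerivAt (fun v : ℝ => (1 - v) * F (5 * (16 / 15 - v)))
      (-F (5 * (16 / 15 - u)) + (1 - u) *
        ((IsLinearSieveFunctions.mulUpperDeriv f (5 * (16 / 15 - u)) - F (5 * (16 / 15 - u))) /
          (5 * (16 / 15 - u)) * (-5))) u := by
  have hφ : HasDerivAt (fun v : ℝ => 5 * (16 / 15 - v)) (-5) u := by
    have h1 := ((hasDerivAt_id u).const_sub (16 / 15 : ℝ)).const_mul (5 : ℝ)
    refine h1.congr_deriv ?_
    norm_num
  have hF := h.hasDerivAt_upper_comp hφ (by linarith : 0 < 5 * (16 / 15 - u))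
  have h2 := HasDerivAt.mul ((hasDerivAt_id' u).const_sub 1) hF
  refine h2.congr_deriv ?_
  ring

/-- Continuity of `g₂'` below `16/15`. [folklore] -/
theorem continuousOn_g2_deriv {F f : ℝ → ℝ} (h : IsLinearSieveFunctions F f) :
    ContinuousOn (fun u : ℝ => -F (5 * (16 / 15 - u)) + (1 - u) *
        ((IsLinearSieveFunctions.mulUpperDeriv f (5 * (16 / 15 - u)) - F (5 * (16 / 15 - u))) /
          (5 * (16 / 15 - u)) * (-5))) (Set.Iio (16 / 15)) := by
  have hφc : Continuous fun u : ℝ => 5 * (16 / 15 - u) := by continuity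
  have hmaps : Set.MapsTo (fun u : ℝ => 5 * (16 / 15 - u)) (Set.Iio (16 / 15)) (Set.Ioi 0) := by
    intro u hu; simp only [Set.mem_Iio] at hu; simp only [Set.mem_Ioi]; linarith
  have hF : ContinuousOn (fun u : ℝ => F (5 * (16 / 15 - u))) (Set.Iio (16 / 15)) :=
    h.continuousOn_upper.comp hφc.continuousOn hmaps
  have hF' : ContinuousOn (fun u : ℝ =>
      (IsLinearSieveFunctions.mulUpperDeriv f (5 * (16 / 15 - u)) - F (5 * (16 / 15 - u))) /
        (5 * (16 / 15 - u))) (Set.Iio (16 / 15)) :=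
    (IsLinearSieveFunctions.continuousOn_upperDeriv h).comp hφc.continuousOn hmaps
  exact hF.neg.add ((continuousOn_const.sub continuousOn_id).mul (hF'.mul continuousOn_const))

/-- **Bound for `M_2`:** under `RhoMertens`, for `0 < ε ≤ 1/4` and every `δ > 0`, eventually
`M_2(x, ε) ≤ ∫_{1/2}^{1−ε} (1 − u) F(5(16/15 − u)) du/u + δ` (the term
`∫_{1/2}^1 (1 − u) F((α−u)/γ) du/u` of p. 186). [cite: IwaniecInventiones1978, §6 p. 186] -/
theorem M2_le (hP : RhoMertens) {F f : ℝ → ℝ} (h : IsLinearSieveFunctions F f) {ε δ : ℝ}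
    (hε : 0 < ε) (hε4 : ε ≤ 1 / 4) (hδ : 0 < δ) :
    ∀ᶠ x : ℝ in atTop,
      ∑ p ∈ primesIn (x ^ (1 / 2 : ℝ)) (x ^ (1 - ε)),
          (1 - Real.log p / Real.log x) * (rho p : ℝ) / p *
            F (Real.log (x ^ (16 / 15 : ℝ) / p) / Real.log (x ^ (1 / 5 : ℝ))) ≤
        (∫ u in (1 / 2 : ℝ)..(1 - ε), (1 - u) * F (5 * (16 / 15 - u)) / u) + δ := by
  set g2 : ℝ → ℝ := fun v => (1 - v) * F (5 * (16 / 15 - v)) with hg2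
  have hab : (1 / 2 : ℝ) ≤ 1 - ε := by linarith
  have hderiv : ∀ u ∈ Set.Icc (1 / 2 : ℝ) (1 - ε), HasDerivAt g2 _ u := fun u hu =>
    hasDerivAt_g2 h (by linarith [hu.2])
  have hcont' := (continuousOn_g2_deriv h).mono
    (show Set.Icc (1 / 2 : ℝ) (1 - ε) ⊆ Set.Iio (16 / 15) from fun u hu => by
      simp only [Set.mem_Iio]; linarith [hu.2])
  have hg2c : ContinuousOn g2 (Set.Icc (1 / 2 : ℝ) (1 - ε)) :=
    fun u hu => (hderiv u hu).continuousAt.continuousWithinAt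
  obtain ⟨H, hH⟩ := isCompact_Icc.exists_bound_of_continuousOn hg2c
  have hH0 : 0 ≤ H := le_trans (norm_nonneg _) (hH (1 / 2) ⟨le_rfl, hab⟩)
  have hlim := tendsto_sum_Ioc_rhoWeight hP (by norm_num : (0 : ℝ) < 1 / 2) hab hderiv hcont'
  have hint : ∫ u in (1 / 2 : ℝ)..(1 - ε), g2 u / u =
      ∫ u in (1 / 2 : ℝ)..(1 - ε), (1 - u) * F (5 * (16 / 15 - u)) / u := by
    rfl
  rw [hint] at hlim
  have hev1 := (Metric.tendsto_nhds.mp hlim) (δ / 2) (by positivity)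
  have hev2 : ∀ᶠ x : ℝ in atTop, 2 * H / x ^ (1 / 2 : ℝ) ≤ δ / 2 := by
    have ht : Tendsto (fun x : ℝ => 2 * H / x ^ (1 / 2 : ℝ)) atTop (𝓝 0) := by
      have := (tendsto_rpow_atTop (by norm_num : (0 : ℝ) < 1 / 2)).inv_tendsto_atTop.const_mul
        (2 * H)
      simpa [div_eq_mul_inv] using this
    exact (ht.eventually (Iic_mem_nhds (by positivity : (0 : ℝ) < δ / 2))).mono fun x hx => hx
  filter_upwards [hev1, hev2, eventually_gt_atTop (1 : ℝ)] with x hx1 hx2 hx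
  have hx0 : 0 < x := by linarith
  have hL0 : 0 < Real.log x := Real.log_pos hx
  have hsum : ∑ p ∈ primesIn (x ^ (1 / 2 : ℝ)) (x ^ (1 - ε)),
      (1 - Real.log p / Real.log x) * (rho p : ℝ) / p *
        F (Real.log (x ^ (16 / 15 : ℝ) / p) / Real.log (x ^ (1 / 5 : ℝ))) =
      ∑ p ∈ primesIn (x ^ (1 / 2 : ℝ)) (x ^ (1 - ε)),
        (rho p : ℝ) / p * g2 (Real.log p / Real.log x) := by
    refine Finset.sum_congr rfl fun p hp => ?_
    have hpp := mem_primesIn.mp hp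
    have hp0 : (0 : ℝ) < p := by exact_mod_cast hpp.1.pos
    have e : Real.log (x ^ (16 / 15 : ℝ) / p) / Real.log (x ^ (1 / 5 : ℝ)) =
        5 * (16 / 15 - Real.log p / Real.log x) := by
      rw [Real.log_div (by positivity) hp0.ne', Real.log_rpow hx0, Real.log_rpow hx0]
      field_simp
    rw [e, hg2]
    ring
  rw [hsum]
  have hcmp := sum_primesIn_le_sum_Ioc (A := x ^ (1 / 2 : ℝ)) (B := x ^ (1 - ε))
    (by positivity) (h := fun k : ℕ => g2 (Real.log k / Real.log x)) hH0 ?_ ?_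
  rotate_left
  · intro k hk
    rw [Finset.mem_Ioc] at hk
    have hk1 : x ^ (1 / 2 : ℝ) < k := (Nat.floor_lt (by positivity)).mp hk.1
    have hk2 : (k : ℝ) ≤ x ^ (1 - ε) := by
      have := Nat.floor_le (show 0 ≤ x ^ (1 - ε) by positivity)
      exact le_trans (by exact_mod_cast hk.2) this
    have hk0 : (0 : ℝ) < k := by linarith [show (0:ℝ) < x ^ (1/2:ℝ) by positivity]
    have hu1 : 1 / 2 < Real.log k / Real.log x := by
      rw [lt_div_iff₀ hL0, ← Real.log_rpow hx0]; exact Real.log_lt_log (by positivity) hk1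
    have hu2 : Real.log k / Real.log x ≤ 1 - ε := by
      rw [div_le_iff₀ hL0, ← Real.log_rpow hx0]; exact Real.log_le_log hk0 hk2
    simp only [hg2]
    exact mul_nonneg (by linarith) (h.upper_nonneg (by linarith) (by linarith))
  · intro p hp
    have hpp := mem_primesIn.mp hp
    have hp0 : (0 : ℝ) < p := by exact_mod_cast hpp.1.pos
    have hu1 : 1 / 2 ≤ Real.log p / Real.log x := by
      rw [le_div_iff₀ hL0, ← Real.log_rpow hx0]; exact Real.log_le_log (by positivity) hpp.2.1
    have hu2 : Real.log p / Real.log x ≤ 1 - ε := by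
      rw [div_le_iff₀ hL0, ← Real.log_rpow hx0]; exact Real.log_le_log hp0 hpp.2.2.le
    have := hH _ ⟨hu1, hu2⟩
    rw [Real.norm_eq_abs] at this
    exact (le_abs_self _).trans this
  have hIoc : ∑ k ∈ Finset.Ioc ⌊x ^ (1 / 2 : ℝ)⌋₊ ⌊x ^ (1 - ε)⌋₊,
      rhoWeight k * g2 (Real.log k / Real.log x) ≤
      (∫ u in (1 / 2 : ℝ)..(1 - ε), (1 - u) * F (5 * (16 / 15 - u)) / u) + δ / 2 := by
    have := hx1
    rw [Real.dist_eq] at this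
    have h' : ∑ k ∈ Finset.Ioc ⌊x ^ (1 / 2 : ℝ)⌋₊ ⌊x ^ (1 - ε)⌋₊,
        rhoWeight k * g2 (Real.log k / Real.log x) =
        ∑ k ∈ Finset.Ioc ⌊x ^ (1 / 2 : ℝ)⌋₊ ⌊x ^ (1 - ε)⌋₊,
          g2 (Real.log k / Real.log x) * rhoWeight k := Finset.sum_congr rfl fun k _ => mul_comm _ _
    rw [h']
    linarith [(abs_lt.mp this).2]
  linarith [hcmp, hIoc, hx2]

/-! #### The weight `g_A(u) = (1 − 2u) F((16/15 − u)/u) (1/5)/u` and the bound for `M_A` -/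

/-- Derivative of the weight `g_A(u) = (1 − 2u) F((16/15 − u)/u) (1/5)/u`. [folklore] -/
theorem hasDerivAt_gA {F f : ℝ → ℝ} (h : IsLinearSieveFunctions F f) {u : ℝ} (hu0 : 0 < u)
    (hu : u < 16 / 15) :
    HasDerivAt (fun v : ℝ => (1 - 2 * v) * F ((16 / 15 - v) / v) * ((1 / 5) / v))
      ((-2 * F ((16 / 15 - u) / u) + (1 - 2 * u) *
          ((IsLinearSieveFunctions.mulUpperDeriv f ((16 / 15 - u) / u) - F ((16 / 15 - u) / u)) /
            ((16 / 15 - u) / u) * (-(16 / 15) / u ^ 2))) * ((1 / 5) / u) +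
        (1 - 2 * u) * F ((16 / 15 - u) / u) * (-(1 / 5) / u ^ 2)) u := by
  have hφ : HasDerivAt (fun v : ℝ => (16 / 15 - v) / v) (-(16 / 15) / u ^ 2) u := by
    have h1 := ((hasDerivAt_id u).const_sub (16 / 15 : ℝ)).div (hasDerivAt_id u) hu0.ne'
    refine h1.congr_deriv ?_
    simp only [id]
    field_simp
    ring
  have hpos : 0 < (16 / 15 - u) / u := div_pos (by linarith) hu0
  have hF := h.hasDerivAt_upper_comp hφ hpos
  have hlin : HasDerivAt (fun v : ℝ => 1 - 2 * v) (-2) u := by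
    have := ((hasDerivAt_id u).const_mul (2 : ℝ)).const_sub 1
    refine this.congr_deriv ?_
    simp
  have hinv : HasDerivAt (fun v : ℝ => (1 / 5) / v) (-(1 / 5) / u ^ 2) u := by
    have := (hasDerivAt_inv hu0.ne').const_mul (1 / 5 : ℝ)
    refine (this.congr_deriv ?_).congr_of_eventuallyEq ?_
    · field_simp
    · exact Eventually.of_forall fun v => by simp [div_eq_mul_inv]
  have h2 := (hlin.mul hF).mul hinv
  exact h2

/-- Continuity of `g_A'` on `(0, 16/15)`. [folklore] -/
theorem continuousOn_gA_deriv {F f : ℝ → ℝ} (h : IsLinearSieveFunctions F f) :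
    ContinuousOn (fun u : ℝ => (-2 * F ((16 / 15 - u) / u) + (1 - 2 * u) *
          ((IsLinearSieveFunctions.mulUpperDeriv f ((16 / 15 - u) / u) - F ((16 / 15 - u) / u)) /
            ((16 / 15 - u) / u) * (-(16 / 15) / u ^ 2))) * ((1 / 5) / u) +
        (1 - 2 * u) * F ((16 / 15 - u) / u) * (-(1 / 5) / u ^ 2)) (Set.Ioo 0 (16 / 15)) := by
  have hφc : ContinuousOn (fun u : ℝ => (16 / 15 - u) / u) (Set.Ioo 0 (16 / 15)) :=
    (continuousOn_const.sub continuousOn_id).div continuousOn_id fun u hu => hu.1.ne'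
  have hmaps : Set.MapsTo (fun u : ℝ => (16 / 15 - u) / u) (Set.Ioo 0 (16 / 15)) (Set.Ioi 0) := by
    intro u hu; simp only [Set.mem_Ioi]; exact div_pos (by linarith [hu.2]) hu.1
  have hF : ContinuousOn (fun u : ℝ => F ((16 / 15 - u) / u)) (Set.Ioo 0 (16 / 15)) :=
    h.continuousOn_upper.comp hφc hmaps
  have hF' : ContinuousOn (fun u : ℝ =>
      (IsLinearSieveFunctions.mulUpperDeriv f ((16 / 15 - u) / u) - F ((16 / 15 - u) / u)) /
        ((16 / 15 - u) / u)) (Set.Ioo 0 (16 / 15)) :=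
    (IsLinearSieveFunctions.continuousOn_upperDeriv h).comp hφc hmaps
  have hu2 : ContinuousOn (fun u : ℝ => -(16 / 15) / u ^ 2) (Set.Ioo 0 (16 / 15)) :=
    continuousOn_const.div (continuousOn_id.pow 2) fun u hu => pow_ne_zero 2 hu.1.ne'
  have hu3 : ContinuousOn (fun u : ℝ => (1 / 5) / u) (Set.Ioo 0 (16 / 15)) :=
    continuousOn_const.div continuousOn_id fun u hu => hu.1.ne'
  have hu4 : ContinuousOn (fun u : ℝ => -(1 / 5) / u ^ 2) (Set.Ioo 0 (16 / 15)) :=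
    continuousOn_const.div (continuousOn_id.pow 2) fun u hu => pow_ne_zero 2 hu.1.ne'
  have hlin : ContinuousOn (fun u : ℝ => 1 - 2 * u) (Set.Ioo 0 (16 / 15)) :=
    continuousOn_const.sub (continuousOn_const.mul continuousOn_id)
  exact (((continuousOn_const.mul hF).add (hlin.mul (hF'.mul hu2))).mul hu3).add
    ((hlin.mul hF).mul hu4)

/-- **Bound for `M_A`:** under `RhoMertens`, for every `δ > 0`, eventually
`M_A(x) ≤ ∫_{1/5}^{1/2} (1 − 2u) F((16/15 − u)/u) (1/5)/u du/u + δ` (`= T3 + δ`; the term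
`∫ (1 − 2u)(γ/u) F((α−u)/u) du/u` of p. 186). [cite: IwaniecInventiones1978, §6 p. 186] -/
theorem MA_le (hP : RhoMertens) {F f : ℝ → ℝ} (h : IsLinearSieveFunctions F f) {δ : ℝ}
    (hδ : 0 < δ) :
    ∀ᶠ x : ℝ in atTop,
      ∑ p ∈ primesIn (x ^ (1 / 5 : ℝ)) (x ^ (1 / 2 : ℝ)),
          (1 - 2 * Real.log p / Real.log x) * (rho p : ℝ) / p *
            F (Real.log (x ^ (16 / 15 : ℝ) / p) / Real.log p) *
              (Real.log (x ^ (1 / 5 : ℝ)) / Real.log p) ≤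
        (∫ u in (1 / 5 : ℝ)..(1 / 2),
          (1 - 2 * u) * F ((16 / 15 - u) / u) * ((1 / 5) / u) / u) + δ := by
  set gA : ℝ → ℝ := fun v => (1 - 2 * v) * F ((16 / 15 - v) / v) * ((1 / 5) / v) with hgA
  have hderiv : ∀ u ∈ Set.Icc (1 / 5 : ℝ) (1 / 2), HasDerivAt gA _ u := fun u hu =>
    hasDerivAt_gA h (by linarith [hu.1]) (by linarith [hu.2])
  have hcont' := (continuousOn_gA_deriv h).mono
    (show Set.Icc (1 / 5 : ℝ) (1 / 2) ⊆ Set.Ioo 0 (16 / 15) from fun u hu =>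
      ⟨by linarith [hu.1], by linarith [hu.2]⟩)
  have hgAc : ContinuousOn gA (Set.Icc (1 / 5 : ℝ) (1 / 2)) :=
    fun u hu => (hderiv u hu).continuousAt.continuousWithinAt
  obtain ⟨H, hH⟩ := isCompact_Icc.exists_bound_of_continuousOn hgAc
  have hH0 : 0 ≤ H := le_trans (norm_nonneg _) (hH (1 / 5) ⟨le_rfl, by norm_num⟩)
  have hlim := tendsto_sum_Ioc_rhoWeight hP (by norm_num : (0 : ℝ) < 1 / 5)
    (by norm_num : (1 / 5 : ℝ) ≤ 1 / 2) hderiv hcont'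
  have hev1 := (Metric.tendsto_nhds.mp hlim) (δ / 2) (by positivity)
  have hev2 : ∀ᶠ x : ℝ in atTop, 2 * H / x ^ (1 / 5 : ℝ) ≤ δ / 2 := by
    have ht : Tendsto (fun x : ℝ => 2 * H / x ^ (1 / 5 : ℝ)) atTop (𝓝 0) := by
      have := (tendsto_rpow_atTop (by norm_num : (0 : ℝ) < 1 / 5)).inv_tendsto_atTop.const_mul
        (2 * H)
      simpa [div_eq_mul_inv] using this
    exact (ht.eventually (Iic_mem_nhds (by positivity : (0 : ℝ) < δ / 2))).mono fun x hx => hx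
  filter_upwards [hev1, hev2, eventually_gt_atTop (1 : ℝ)] with x hx1 hx2 hx
  have hx0 : 0 < x := by linarith
  have hL0 : 0 < Real.log x := Real.log_pos hx
  have hz1 : 1 < x ^ (1 / 5 : ℝ) := Real.one_lt_rpow hx (by norm_num)
  have hsum : ∑ p ∈ primesIn (x ^ (1 / 5 : ℝ)) (x ^ (1 / 2 : ℝ)),
      (1 - 2 * Real.log p / Real.log x) * (rho p : ℝ) / p *
        F (Real.log (x ^ (16 / 15 : ℝ) / p) / Real.log p) *
          (Real.log (x ^ (1 / 5 : ℝ)) / Real.log p) =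
      ∑ p ∈ primesIn (x ^ (1 / 5 : ℝ)) (x ^ (1 / 2 : ℝ)),
        (rho p : ℝ) / p * gA (Real.log p / Real.log x) := by
    refine Finset.sum_congr rfl fun p hp => ?_
    have hpp := mem_primesIn.mp hp
    have hp0 : (0 : ℝ) < p := by exact_mod_cast hpp.1.pos
    have hp1 : (1 : ℝ) < p := hz1.trans_le hpp.2.1
    have hlogp : 0 < Real.log p := Real.log_pos hp1
    have e1 : Real.log (x ^ (16 / 15 : ℝ) / p) / Real.log p =
        (16 / 15 - Real.log p / Real.log x) / (Real.log p / Real.log x) := by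
      rw [Real.log_div (by positivity) hp0.ne', Real.log_rpow hx0]
      field_simp
    have e2 : Real.log (x ^ (1 / 5 : ℝ)) / Real.log p = (1 / 5) / (Real.log p / Real.log x) := by
      rw [Real.log_rpow hx0]
      field_simp
    rw [e1, e2, hgA]
    ring
  rw [hsum]
  have hcmp := sum_primesIn_le_sum_Ioc (A := x ^ (1 / 5 : ℝ)) (B := x ^ (1 / 2 : ℝ))
    (by positivity) (h := fun k : ℕ => gA (Real.log k / Real.log x)) hH0 ?_ ?_
  rotate_left
  · intro k hk
    rw [Finset.mem_Ioc] at hk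
    have hk1 : x ^ (1 / 5 : ℝ) < k := (Nat.floor_lt (by positivity)).mp hk.1
    have hk2 : (k : ℝ) ≤ x ^ (1 / 2 : ℝ) := by
      have := Nat.floor_le (show 0 ≤ x ^ (1 / 2 : ℝ) by positivity)
      exact le_trans (by exact_mod_cast hk.2) this
    have hk0 : (0 : ℝ) < k := by linarith
    have hu1 : 1 / 5 < Real.log k / Real.log x := by
      rw [lt_div_iff₀ hL0, ← Real.log_rpow hx0]; exact Real.log_lt_log (by positivity) hk1
    have hu2 : Real.log k / Real.log x ≤ 1 / 2 := by
      rw [div_le_iff₀ hL0, ← Real.log_rpow hx0]; exact Real.log_le_log hk0 hk2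
    set u := Real.log k / Real.log x with hu
    simp only [hgA]
    have hφ1 : 0 < (16 / 15 - u) / u := div_pos (by linarith) (by linarith)
    have hφ2 : (16 / 15 - u) / u ≤ 5 := by
      rw [div_le_iff₀ (by linarith : (0:ℝ) < u)]; linarith
    exact mul_nonneg (mul_nonneg (by linarith) (h.upper_nonneg hφ1 hφ2)) (by positivity)
  · intro p hp
    have hpp := mem_primesIn.mp hp
    have hp0 : (0 : ℝ) < p := by exact_mod_cast hpp.1.pos
    have hu1 : 1 / 5 ≤ Real.log p / Real.log x := by
      rw [le_div_iff₀ hL0, ← Real.log_rpow hx0]; exact Real.log_le_log (by positivity) hpp.2.1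
    have hu2 : Real.log p / Real.log x ≤ 1 / 2 := by
      rw [div_le_iff₀ hL0, ← Real.log_rpow hx0]; exact Real.log_le_log hp0 hpp.2.2.le
    have := hH _ ⟨hu1, hu2⟩
    rw [Real.norm_eq_abs] at this
    exact (le_abs_self _).trans this
  have hIoc : ∑ k ∈ Finset.Ioc ⌊x ^ (1 / 5 : ℝ)⌋₊ ⌊x ^ (1 / 2 : ℝ)⌋₊,
      rhoWeight k * gA (Real.log k / Real.log x) ≤
      (∫ u in (1 / 5 : ℝ)..(1 / 2), gA u / u) + δ / 2 := by
    have := hx1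
    rw [Real.dist_eq] at this
    have h' : ∑ k ∈ Finset.Ioc ⌊x ^ (1 / 5 : ℝ)⌋₊ ⌊x ^ (1 / 2 : ℝ)⌋₊,
        rhoWeight k * gA (Real.log k / Real.log x) =
        ∑ k ∈ Finset.Ioc ⌊x ^ (1 / 5 : ℝ)⌋₊ ⌊x ^ (1 / 2 : ℝ)⌋₊,
          gA (Real.log k / Real.log x) * rhoWeight k := Finset.sum_congr rfl fun k _ => mul_comm _ _
    rw [h']
    linarith [(abs_lt.mp this).2]
  have hint : ∫ u in (1 / 5 : ℝ)..(1 / 2), gA u / u =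
      ∫ u in (1 / 5 : ℝ)..(1 / 2), (1 - 2 * u) * F ((16 / 15 - u) / u) * ((1 / 5) / u) / u := rfl
  rw [hint] at hIoc
  linarith [hcmp, hIoc, hx2]

/-! ### F2: Mertens-type asymptotics for `ρ` — PROVED from the tree -/

/-- `N(z) = ⌈z⌉₊ − 1`, so that `{p < z} = {p ≤ N(z)}`. [folklore] -/
def ceilPred (z : ℝ) : ℕ := ⌈z⌉₊ - 1

/-- `{p < z} = {p ≤ N(z)}`. [folklore] -/
theorem primesBelow_ceil (z : ℝ) : Nat.primesBelow ⌈z⌉₊ = Nat.primesLE (ceilPred z) :=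
  Nat.primesBelow_eq_primesLE_sub_one _

/-- `N(z) → ∞`. [folklore] -/
theorem tendsto_ceilPred : Tendsto ceilPred atTop atTop := by
  refine tendsto_atTop_atTop.mpr fun n => ⟨(n : ℝ) + 1, fun z hz => ?_⟩
  unfold ceilPred
  have : n + 1 ≤ ⌈z⌉₊ := by
    have h : ((n + 1 : ℕ) : ℝ) ≤ z := by push_cast; exact hz
    exact Nat.cast_le.mp (h.trans (Nat.le_ceil z))
  omega

/-- `N(z) < z` for `z > 0`. [folklore] -/
theorem ceilPred_lt {z : ℝ} (hz : 0 < z) : (ceilPred z : ℝ) < z := by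
  unfold ceilPred
  have h := Nat.ceil_lt_add_one hz.le
  have h1 : 1 ≤ ⌈z⌉₊ := Nat.one_le_iff_ne_zero.mpr (Nat.ceil_pos.mpr hz).ne'
  rw [Nat.cast_sub h1, Nat.cast_one]
  linarith

/-- `z ≤ N(z) + 1`. [folklore] -/
theorem le_ceilPred_add_one (z : ℝ) : z ≤ (ceilPred z : ℝ) + 1 := by
  unfold ceilPred
  rcases Nat.eq_zero_or_pos ⌈z⌉₊ with h | h
  · rw [h]; simp; exact (Nat.ceil_eq_zero.mp h).trans (by norm_num)
  · rw [Nat.cast_sub h, Nat.cast_one, sub_add_cancel]; exact Nat.le_ceil z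

/-- `log z / log N(z) → 1`. [folklore] -/
theorem tendsto_log_div_log_ceilPred :
    Tendsto (fun z : ℝ => Real.log z / Real.log (ceilPred z)) atTop (𝓝 1) := by
  -- `log z = log N + (log z - log N)` with `0 ≤ log z - log N ≤ 1/N`
  have hN := tendsto_ceilPred
  have hlogN : Tendsto (fun z : ℝ => Real.log (ceilPred z)) atTop atTop :=
    Real.tendsto_log_atTop.comp (tendsto_natCast_atTop_atTop.comp hN)
  have hdiff : Tendsto (fun z : ℝ => (Real.log z - Real.log (ceilPred z)) / Real.log (ceilPred z))
      atTop (𝓝 0) := by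
    have hnum : Tendsto (fun z : ℝ => Real.log z - Real.log (ceilPred z)) atTop (𝓝 0) := by
      have hinv : Tendsto (fun z : ℝ => ((ceilPred z : ℝ))⁻¹) atTop (𝓝 0) :=
        tendsto_inv_atTop_zero.comp (tendsto_natCast_atTop_atTop.comp hN)
      refine squeeze_zero' ?_ ?_ hinv
      · filter_upwards [eventually_gt_atTop (1 : ℝ), hN.eventually_ge_atTop 1] with z hz hN1
        have hN0 : (0 : ℝ) < ceilPred z := by exact_mod_cast hN1
        exact sub_nonneg.mpr (Real.log_le_log hN0 (ceilPred_lt (by linarith)).le)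
      · filter_upwards [eventually_gt_atTop (1 : ℝ), hN.eventually_ge_atTop 1] with z hz hN1
        have hN0 : (0 : ℝ) < ceilPred z := by exact_mod_cast hN1
        rw [← Real.log_div (by linarith) hN0.ne']
        calc Real.log (z / ceilPred z) ≤ z / ceilPred z - 1 :=
              Real.log_le_sub_one_of_pos (by positivity)
          _ ≤ ((ceilPred z : ℝ))⁻¹ := by
            rw [div_sub_one hN0.ne', div_le_iff₀ hN0, inv_mul_cancel₀ hN0.ne']
            linarith [le_ceilPred_add_one z]
    have := hnum.div_atTop hlogN
    exact this
  have h1 : Tendsto (fun z : ℝ => 1 + (Real.log z - Real.log (ceilPred z)) / Real.log (ceilPred z))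
      atTop (𝓝 1) := by simpa using hdiff.const_add 1
  refine h1.congr' ?_
  filter_upwards [hlogN.eventually_gt_atTop 0] with z hz
  field_simp
  ring

/-- **`V(z) log z → C e^{-γ}`** with `C = hardyLittlewoodEConst = 2Γ` (p. 187, "from Mertens prime
number theorem we have `V(z) ∼ Γ_G e^{-C}(log z)^{-1}`" — the printed line drops the factor
`g = 2`; the correct constant is `2Γ e^{-γ}`): PROVED from the tree's Bateman–Horn convergence
(`IsBatemanHornSystem.hasBatemanHornConst_holds`) and Mertens' theorem
(`Literature.NumberTheory.LFunctions.Mertens.tendsto_log_mul_prod_one_sub_inv_nat`). [cite: IwaniecInventiones1978, §6 p. 187] -/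
theorem tendsto_densityProd_mul_log :
    Tendsto (fun z : ℝ => densityProd z * Real.log z) atTop
      (𝓝 (hardyLittlewoodEConst * Real.exp (-Real.eulerMascheroniConstant))) := by
  set f : Fin 1 → ℤ[X] := ![(Polynomial.X ^ 2 + 1 : ℤ[X])] with hf
  have hBH : Tendsto (batemanHornPartial f) atTop (𝓝 hardyLittlewoodEConst) :=
    (IsBatemanHornSystem.hasBatemanHornConst_holds isBatemanHornSystem_X_sq_add_one).1
  have hM := Literature.NumberTheory.LFunctions.Mertens.tendsto_log_mul_prod_one_sub_inv_nat
  -- factorisation `V(z) = BHP(N) * ∏_{p ≤ N} (1 - 1/p)`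
  have hfac : ∀ z : ℝ, densityProd z =
      batemanHornPartial f (ceilPred z) * ∏ p ∈ Nat.primesLE (ceilPred z), (1 - (p : ℝ)⁻¹) := by
    intro z
    rw [densityProd, primesBelow_ceil, batemanHornPartial, ← Finset.prod_mul_distrib]
    refine Finset.prod_congr rfl fun p hp => ?_
    have hpp : p.Prime := (Nat.mem_primesLE.mp hp).2
    have hp0 : (p : ℝ) ≠ 0 := by exact_mod_cast hpp.ne_zero
    have h1 : (1 - (p : ℝ)⁻¹) ≠ 0 := by
      rw [sub_ne_zero, ne_comm]
      exact (inv_lt_one_of_one_lt₀ (by exact_mod_cast hpp.one_lt)).ne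
    rw [rho_eq_polyRootCountMod, ← hf, Fintype.card_fin, pow_one, one_div,
      mul_comm ((1 - (p : ℝ)⁻¹)⁻¹) _, mul_assoc, inv_mul_cancel₀ h1, mul_one]
  have hcomb : Tendsto (fun z : ℝ => batemanHornPartial f (ceilPred z) *
      (Real.log (ceilPred z) * ∏ p ∈ Nat.primesLE (ceilPred z), (1 - (p : ℝ)⁻¹)) *
        (Real.log z / Real.log (ceilPred z))) atTop
      (𝓝 (hardyLittlewoodEConst * Real.exp (-Real.eulerMascheroniConstant) * 1)) :=
    ((hBH.comp tendsto_ceilPred).mul (hM.comp tendsto_ceilPred)).mul tendsto_log_div_log_ceilPred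
  rw [mul_one] at hcomb
  refine hcomb.congr' ?_
  have hlogN : Tendsto (fun z : ℝ => Real.log (ceilPred z)) atTop atTop :=
    Real.tendsto_log_atTop.comp (tendsto_natCast_atTop_atTop.comp tendsto_ceilPred)
  filter_upwards [hlogN.eventually_gt_atTop 0] with z hz
  rw [hfac z]
  field_simp

/-- `∑_{p < t} ρ(p)/p − log log t` converges (to `B₁ − L`, `L = ∑_p (1 − ρ(p))/p`): PROVED from
Mertens' second theorem with its constant (`Literature.NumberTheory.LFunctions.Mertens.tendsto_primeRecipSum_sub_loglog`) and
`AZFG2020_tendsto_sum_sub_omega_div_holds`. [folklore] -/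
theorem tendsto_sum_rho_div_sub_loglog :
    ∃ b : ℝ, Tendsto (fun t : ℝ =>
        ∑ p ∈ Nat.primesBelow ⌈t⌉₊, (rho p : ℝ) / p - Real.log (Real.log t))
      atTop (𝓝 b) := by
  set f : Fin 1 → ℤ[X] := ![(Polynomial.X ^ 2 + 1 : ℤ[X])] with hf
  obtain ⟨L, hL⟩ := AZFG2020_tendsto_sum_sub_omega_div_holds 1 f isBatemanHornSystem_X_sq_add_one
  have hM := Literature.NumberTheory.LFunctions.Mertens.tendsto_primeRecipSum_sub_loglog
  refine ⟨Literature.NumberTheory.LFunctions.Mertens.meisselMertens - L, ?_⟩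
  -- decomposition `∑ ρ(p)/p = ∑ 1/p − ∑ (1 − ρ(p))/p` over `p ≤ N(t)`
  have hdec : ∀ t : ℝ, ∑ p ∈ Nat.primesBelow ⌈t⌉₊, (rho p : ℝ) / p =
      Literature.NumberTheory.LFunctions.Mertens.primeRecipSum (ceilPred t) -
        ∑ p ∈ Nat.primesLE (ceilPred t), ((1 : ℕ) - (polyRootCountMod f p : ℝ)) / p := by
    intro t
    rw [Literature.NumberTheory.LFunctions.Mertens.primeRecipSum, Nat.floor_natCast, primesBelow_ceil, ← Finset.sum_sub_distrib]
    refine Finset.sum_congr rfl fun p hp => ?_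
    rw [rho_eq_polyRootCountMod]
    push_cast
    ring
  -- `log log N(t) − log log t → 0`
  have hll : Tendsto (fun t : ℝ => Real.log (Real.log (ceilPred t)) - Real.log (Real.log t))
      atTop (𝓝 0) := by
    have h1 : Tendsto (fun t : ℝ => Real.log (Real.log (ceilPred t) / Real.log t)) atTop (𝓝 0) := by
      have hinv : Tendsto (fun t : ℝ => Real.log (ceilPred t) / Real.log t) atTop (𝓝 1) := by
        have := tendsto_log_div_log_ceilPred.inv₀ one_ne_zero
        rw [inv_one] at this
        exact this.congr fun t => by simp [inv_div]
      have h2 := (Real.continuousAt_log one_ne_zero).tendsto.comp hinv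
      rw [Real.log_one] at h2
      exact h2
    refine h1.congr' ?_
    have hlogN : Tendsto (fun z : ℝ => Real.log (ceilPred z)) atTop atTop :=
      Real.tendsto_log_atTop.comp (tendsto_natCast_atTop_atTop.comp tendsto_ceilPred)
    filter_upwards [hlogN.eventually_gt_atTop 0,
      (Real.tendsto_log_atTop).eventually_gt_atTop 0] with t h1 h2
    rw [Real.log_div h1.ne' h2.ne']
  have hcomb := ((hM.comp (tendsto_natCast_atTop_atTop.comp tendsto_ceilPred)).add hll).sub
    (hL.comp tendsto_ceilPred)
  rw [add_zero] at hcomb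
  refine hcomb.congr' (Eventually.of_forall fun t => ?_)
  simp only [Function.comp_apply, hdec t]
  ring


/-- **`P(t) = ∑_{p ≤ t} ρ(p)/p = log log t + b + o(1)`** (the partial-summation input of §6,
cf. arXiv:1910.02885 Lemma 14, there via Nagel's Mertens-type theorem): PROVED from Mertens II with
its constant and the convergence of `∑_p (1 − ρ(p))/p` (AZFG 2020 (5.4.4), proved in the tree).
[cite: IwaniecInventiones1978, §6 p. 186] -/
theorem tendsto_sum_primesLE_rho_div_sub_loglog : RhoMertens := by
  set f : Fin 1 → ℤ[X] := ![(Polynomial.X ^ 2 + 1 : ℤ[X])] with hf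
  obtain ⟨L, hL⟩ := AZFG2020_tendsto_sum_sub_omega_div_holds 1 f isBatemanHornSystem_X_sq_add_one
  have hM := Literature.NumberTheory.LFunctions.Mertens.tendsto_primeRecipSum_sub_loglog
  refine ⟨Literature.NumberTheory.LFunctions.Mertens.meisselMertens - L, ?_⟩
  have hdec : ∀ t : ℝ, ∑ p ∈ Nat.primesLE ⌊t⌋₊, (rho p : ℝ) / p =
      Literature.NumberTheory.LFunctions.Mertens.primeRecipSum t -
        ∑ p ∈ Nat.primesLE ⌊t⌋₊, ((1 : ℕ) - (polyRootCountMod f p : ℝ)) / p := by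
    intro t
    rw [Literature.NumberTheory.LFunctions.Mertens.primeRecipSum, ← Finset.sum_sub_distrib]
    refine Finset.sum_congr rfl fun p hp => ?_
    rw [rho_eq_polyRootCountMod]
    push_cast
    ring
  have hfloor : Tendsto (fun t : ℝ => ⌊t⌋₊) atTop atTop := tendsto_nat_floor_atTop
  have hcomb := hM.sub (hL.comp hfloor)
  refine hcomb.congr' (Eventually.of_forall fun t => ?_)
  simp only [Function.comp_apply, hdec t]
  ring


/-! ### F4c: the assembly `weightedSum_lower` from Prop. 2 + Mertens-type inputs + numerics -/

/-- Truncating the `T5` integral at `1 − ε` only decreases it (integrand `≥ 0`). [folklore] -/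
theorem T5_trunc_le {F f : ℝ → ℝ} (h : IsLinearSieveFunctions F f) {ε : ℝ} (hε : 0 < ε)
    (hε2 : ε ≤ 1 / 2) :
    ∫ u in (1 / 2 : ℝ)..(1 - ε), (1 - u) * F (5 * (16 / 15 - u)) / u ≤
      ∫ u in (1 / 2 : ℝ)..1, (1 - u) * F (5 * (16 / 15 - u)) / u := by
  have hcont : ContinuousOn (fun u : ℝ => (1 - u) * F (5 * (16 / 15 - u)) / u)
      (Set.Icc (1 / 2) 1) := by
    refine ContinuousOn.div (ContinuousOn.mul (continuousOn_const.sub continuousOn_id) ?_)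
      continuousOn_id fun u hu => by linarith [hu.1]
    refine h.continuousOn_upper.comp (by fun_prop) fun u hu => ?_
    simp only [Set.mem_Ioi]; linarith [hu.2]
  refine intervalIntegral.integral_mono_interval le_rfl (by linarith) (by linarith) ?_
    (hcont.intervalIntegrable_of_Icc (by norm_num))
  rw [Filter.EventuallyLE, ae_restrict_iff' measurableSet_Ioc]
  refine Eventually.of_forall fun u hu => ?_
  have hu1 := hu.1; have hu2 := hu.2
  exact div_nonneg (mul_nonneg (by linarith) (h.upper_nonneg (by linarith) (by linarith)))
    (by linarith)

/-- **(2) from Proposition 2 — PROVED modulo the analytic inputs listed.**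
Iwaniec's weighted-sieve inequality (2) at `z = x^{1/5}` (`weightedSum_lower`) follows from
Proposition 2 (upper and lower), the linear-sieve functions `F, f`, the Mertens-type asymptotics
`∑_{p ≤ t} ρ(p)/p = log log t + b + o(1)` and `V(z) log z → C e^{-γ}` (`C = 2Γ`), and the numerical
inequality `e^γ/770 < f(16/3) − T3 − T4 − T5` of §6 (the double sum being dropped).
[cite: IwaniecInventiones1978, §6 pp. 186–187] -/
theorem weightedSum_lower_of_prop2_const (h2u : proposition2_upper) (h2l : proposition2_lower_const)
    {F f : ℝ → ℝ} (hFf : IsLinearSieveFunctions F f) (hP : RhoMertens)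
    (hV : Tendsto (fun z : ℝ => densityProd z * Real.log z) atTop
      (𝓝 (hardyLittlewoodEConst * Real.exp (-Real.eulerMascheroniConstant))))
    (hnum : Real.exp Real.eulerMascheroniConstant / 770 <
      f (16 / 3)
        - (∫ u in (1 / 5 : ℝ)..(1 / 2), (1 - 2 * u) * F ((16 / 15 - u) / u) * ((1 / 5) / u) / u)
        - (∫ u in (1 / 5 : ℝ)..(1 / 2), F (5 * (16 / 15 - u)))
        - (∫ u in (1 / 2 : ℝ)..1, (1 - u) * F (5 * (16 / 15 - u)) / u)) :
    weightedSum_lower := by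
  set T3 := ∫ u in (1 / 5 : ℝ)..(1 / 2), (1 - 2 * u) * F ((16 / 15 - u) / u) * ((1 / 5) / u) / u
  set T4 := ∫ u in (1 / 5 : ℝ)..(1 / 2), F (5 * (16 / 15 - u))
  set T5 := ∫ u in (1 / 2 : ℝ)..1, (1 - u) * F (5 * (16 / 15 - u)) / u
  set θ := Real.exp Real.eulerMascheroniConstant / 770 with hθ
  set σ := f (16 / 3) - T3 - T4 - T5 - θ with hσ
  have hσ0 : 0 < σ := by rw [hσ]; linarith
  obtain ⟨C, hC⟩ := weightedSum_ge_of_prop2_const h2u h2l hFf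
  set C' := max C 0 with hC'
  have hC'0 : 0 ≤ C' := le_max_right _ _
  -- choice of `ε`
  set ε := min (1 / 4 : ℝ) (σ / (8 * (C' + 1))) with hεdef
  have hε0 : 0 < ε := by rw [hεdef]; positivity
  have hε4 : ε ≤ 1 / 4 := min_le_left _ _
  have hCε : C' * ε ≤ σ / 8 := by
    have h1 : ε ≤ σ / (8 * (C' + 1)) := min_le_right _ _
    have h2 : C' * ε ≤ (C' + 1) * ε := by nlinarith
    calc C' * ε ≤ (C' + 1) * ε := h2
      _ ≤ (C' + 1) * (σ / (8 * (C' + 1))) := by gcongr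
      _ = σ / 8 := by field_simp
  obtain ⟨x₀, hx₀⟩ := hC ε hε0 hε4
  -- the three main-sum bounds with `δ = σ/8`
  have hδ : 0 < σ / 8 := by positivity
  have hA := MA_le hP hFf hδ
  have hB := MB_le hP hFf hδ
  have h2 := M2_le hP hFf hε0 hε4 hδ
  have hT5 := T5_trunc_le hFf hε0 (by linarith)
  -- the density: eventually `V(z) log z ≥ (1 − η) C₀ e^{-γ}`
  set C₀ := hardyLittlewoodEConst * Real.exp (-Real.eulerMascheroniConstant) with hC₀
  have hHL : hardyLittlewoodEConst = 2 * gamma := by rw [gamma]; ring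
  have hC₀pos : 0 < C₀ := by rw [hC₀, hHL]; exact mul_pos (by linarith [gamma_pos]) (Real.exp_pos _)
  set κ := 385 * Real.exp (-Real.eulerMascheroniConstant) * σ with hκ
  have hκ0 : 0 < κ := by positivity
  set η := κ / (2 * (1 + κ)) with hη
  have hη0 : 0 < η := by positivity
  have hη1 : η < 1 := by
    rw [hη, div_lt_one (by positivity)]; nlinarith
  have hVev : ∀ᶠ x : ℝ in atTop,
      (1 - η) * C₀ ≤ densityProd (x ^ (1 / 5 : ℝ)) * Real.log (x ^ (1 / 5 : ℝ)) := by
    have ht := hV.comp (tendsto_rpow_atTop (by norm_num : (0 : ℝ) < 1 / 5))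
    have hlt : (1 - η) * C₀ < C₀ := by nlinarith
    exact ht.eventually_const_le hlt
  -- assemble
  unfold weightedSum_lower
  filter_upwards [hA, hB, h2, hVev, eventually_ge_atTop x₀, eventually_gt_atTop (1 : ℝ)]
    with x hxA hxB hx2 hxV hxx₀ hx1
  have hx0 : 0 < x := by linarith
  have hL0 : 0 < Real.log x := Real.log_pos hx1
  have hmain := hx₀ x hxx₀
  set V := densityProd (x ^ (1 / 5 : ℝ)) with hVx
  have hlogz : Real.log (x ^ (1 / 5 : ℝ)) = (1 / 5) * Real.log x := Real.log_rpow hx0 _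
  have hV0 : 0 ≤ V := by
    have := hxV
    rw [hlogz] at this
    have h1 : 0 < (1 - η) * C₀ := mul_pos (by linarith) hC₀pos
    by_contra hneg
    rw [not_le] at hneg
    have : V * (1 / 5 * Real.log x) < 0 := mul_neg_of_neg_of_pos hneg (by positivity)
    linarith
  -- lower bound for the bracket
  have hbr : f (16 / 3) - T3 - T4 - T5 - σ / 2 ≤
      f (16 / 3)
        - ∑ p ∈ primesIn (x ^ (1 / 5 : ℝ)) (x ^ (1 / 2 : ℝ)),
            (1 - 2 * Real.log p / Real.log x) * (rho p : ℝ) / p *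
              F (Real.log (x ^ (16 / 15 : ℝ) / p) / Real.log p) *
                (Real.log (x ^ (1 / 5 : ℝ)) / Real.log p)
        - ∑ p ∈ primesIn (x ^ (1 / 5 : ℝ)) (x ^ (1 / 2 : ℝ)),
            Real.log p / Real.log x * (rho p : ℝ) / p *
              F (Real.log (x ^ (16 / 15 : ℝ) / p) / Real.log (x ^ (1 / 5 : ℝ)))
        - ∑ p ∈ primesIn (x ^ (1 / 2 : ℝ)) (x ^ (1 - ε)),
            (1 - Real.log p / Real.log x) * (rho p : ℝ) / p *
              F (Real.log (x ^ (16 / 15 : ℝ) / p) / Real.log (x ^ (1 / 5 : ℝ)))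
        - C * ε := by
    have hCC : C * ε ≤ C' * ε := mul_le_mul_of_nonneg_right (le_max_left _ _) hε0.le
    linarith [hxA, hxB, hx2, hT5, hCε, hCC]
  have hW : V * x * (f (16 / 3) - T3 - T4 - T5 - σ / 2) ≤ weightedSum x (x ^ (1 / 5 : ℝ)) :=
    le_trans (mul_le_mul_of_nonneg_left hbr (mul_nonneg hV0 hx0.le)) hmain
  -- `f(16/3) − T3 − T4 − T5 − σ/2 = θ + σ/2`
  have hval : f (16 / 3) - T3 - T4 - T5 - σ / 2 = θ + σ / 2 := by rw [hσ]; ring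
  rw [hval] at hW
  -- compare `V x (θ + σ/2)` with `(Γ/77) x / log x`
  have hVlow : (1 - η) * C₀ / ((1 / 5) * Real.log x) ≤ V := by
    rw [div_le_iff₀ (by positivity), ← hlogz]; exact hxV
  have hkey : gamma / 77 < (1 - η) * C₀ / (1 / 5) * (θ + σ / 2) := by
    -- `(1 − η)(1 + κ) = 1 + κ/2 > 1` and `5 C₀ θ = C₀ e^{-γ} e^{γ}/154 = (2Γ)/154`
    have hexp :
        Real.exp (-Real.eulerMascheroniConstant) * Real.exp Real.eulerMascheroniConstant = 1 := by
      rw [← Real.exp_add]; simp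
    have h1 : (1 - η) * (1 + κ) = 1 + κ / 2 := by
      rw [hη]; field_simp; ring
    have hE := Real.exp_pos (-Real.eulerMascheroniConstant)
    rw [hC₀, hHL, hθ]
    have hg := gamma_pos
    -- target: Γ/77 < (1-η) (2Γ e^{-γ}) · 5 · (e^{γ}/770 + σ/2)
    have : (1 - η) * (2 * gamma * Real.exp (-Real.eulerMascheroniConstant)) / (1 / 5) *
        (Real.exp Real.eulerMascheroniConstant / 770 + σ / 2) =
        gamma / 77 * ((1 - η) * (1 + κ)) := by
      rw [hκ]; linear_combination ((1 - η) * gamma / 77) * hexp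
    rw [this, h1]
    have hpos : 0 < gamma / 77 * (κ / 2) := by positivity
    have hexpand : gamma / 77 * (1 + κ / 2) = gamma / 77 + gamma / 77 * (κ / 2) := by ring
    rw [hexpand]
    linarith
  have hxL : 0 < x / Real.log x := by positivity
  calc gamma / 77 * x / Real.log x = gamma / 77 * (x / Real.log x) := by ring
    _ < (1 - η) * C₀ / (1 / 5) * (θ + σ / 2) * (x / Real.log x) :=
        mul_lt_mul_of_pos_right hkey hxL
    _ = (1 - η) * C₀ / ((1 / 5) * Real.log x) * x * (θ + σ / 2) := by
        field_simp
    _ ≤ V * x * (θ + σ / 2) :=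
        mul_le_mul_of_nonneg_right (mul_le_mul_of_nonneg_right hVlow hx0.le) (by positivity)
    _ ≤ weightedSum x (x ^ (1 / 5 : ℝ)) := hW

/-- **(2) from Proposition 2 — PROVED modulo the analytic inputs listed.**
Iwaniec's weighted-sieve inequality (2) at `z = x^{1/5}` (`weightedSum_lower`) follows from
Proposition 2 (upper and lower), the linear-sieve functions `F, f`, the Mertens-type asymptotics
`∑_{p ≤ t} ρ(p)/p = log log t + b + o(1)` and `V(z) log z → C e^{-γ}` (`C = 2Γ`), and the numerical
inequality `e^γ/770 < f(16/3) − T3 − T4 − T5` of §6 (the double sum being dropped).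
[cite: IwaniecInventiones1978, §6 pp. 186–187] -/
theorem weightedSum_lower_of_prop2 (h2u : proposition2_upper) (h2l : proposition2_lower)
    {F f : ℝ → ℝ} (hFf : IsLinearSieveFunctions F f) (hP : RhoMertens)
    (hV : Tendsto (fun z : ℝ => densityProd z * Real.log z) atTop
      (𝓝 (hardyLittlewoodEConst * Real.exp (-Real.eulerMascheroniConstant))))
    (hnum : Real.exp Real.eulerMascheroniConstant / 770 <
      f (16 / 3)
        - (∫ u in (1 / 5 : ℝ)..(1 / 2), (1 - 2 * u) * F ((16 / 15 - u) / u) * ((1 / 5) / u) / u)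
        - (∫ u in (1 / 5 : ℝ)..(1 / 2), F (5 * (16 / 15 - u)))
        - (∫ u in (1 / 2 : ℝ)..1, (1 - u) * F (5 * (16 / 15 - u)) / u)) :
    weightedSum_lower :=
  weightedSum_lower_of_prop2_const h2u h2l.const hFf hP hV hnum

/-- **(2) from Proposition 2 and the numerics alone — PROVED.**  With the Mertens-type inputs
discharged (`tendsto_sum_primesLE_rho_div_sub_loglog`, `tendsto_densityProd_mul_log`):
`proposition2_upper → proposition2_lower → IsLinearSieveFunctions F f →
(e^γ/770 < f(16/3) − T3 − T4 − T5) → weightedSum_lower`. [cite: IwaniecInventiones1978, §6] -/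
theorem weightedSum_lower_of_prop2_of_numerics_const (h2u : proposition2_upper)
    (h2l : proposition2_lower_const)
    {F f : ℝ → ℝ} (hFf : IsLinearSieveFunctions F f)
    (hnum : Real.exp Real.eulerMascheroniConstant / 770 <
      f (16 / 3)
        - (∫ u in (1 / 5 : ℝ)..(1 / 2), (1 - 2 * u) * F ((16 / 15 - u) / u) * ((1 / 5) / u) / u)
        - (∫ u in (1 / 5 : ℝ)..(1 / 2), F (5 * (16 / 15 - u)))
        - (∫ u in (1 / 2 : ℝ)..1, (1 - u) * F (5 * (16 / 15 - u)) / u)) :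
    weightedSum_lower :=
  weightedSum_lower_of_prop2_const h2u h2l hFf tendsto_sum_primesLE_rho_div_sub_loglog
    tendsto_densityProd_mul_log hnum

/-- **(2) from Proposition 2 and the numerics alone — PROVED.**  With the Mertens-type inputs
discharged (`tendsto_sum_primesLE_rho_div_sub_loglog`, `tendsto_densityProd_mul_log`):
`proposition2_upper → proposition2_lower → IsLinearSieveFunctions F f →
(e^γ/770 < f(16/3) − T3 − T4 − T5) → weightedSum_lower`. [cite: IwaniecInventiones1978, §6] -/
theorem weightedSum_lower_of_prop2_of_numerics (h2u : proposition2_upper) (h2l : proposition2_lower)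
    {F f : ℝ → ℝ} (hFf : IsLinearSieveFunctions F f)
    (hnum : Real.exp Real.eulerMascheroniConstant / 770 <
      f (16 / 3)
        - (∫ u in (1 / 5 : ℝ)..(1 / 2), (1 - 2 * u) * F ((16 / 15 - u) / u) * ((1 / 5) / u) / u)
        - (∫ u in (1 / 5 : ℝ)..(1 / 2), F (5 * (16 / 15 - u)))
        - (∫ u in (1 / 2 : ℝ)..1, (1 - u) * F (5 * (16 / 15 - u)) / u)) :
    weightedSum_lower :=
  weightedSum_lower_of_prop2_of_numerics_const h2u h2l.const hFf hnum

end Limits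

/-! ### Existence of the linear-sieve functions — from the tree's method of steps

`IsLinearSieveFunctions` (first file) is the delay-differential characterisation of the
Jurkat–Richert functions printed in Lemma 2 (p. 175); it carries NO normalisation at infinity, so a
solution is simply the forward solution of the `β`-sieve system with `κ = 1`, `β = 2`, `A = 2e^γ`
constructed in `Literature/NumberTheory/Sieve/BetaSieveForward.lean` (`Literature.NumberTheory.Sieve.BetaSieveForward.upper`,
`.lower`).  Hence the facts of the first file quantified over `IsLinearSieveFunctions F f`
(Proposition 2) are not vacuous, and `weightedSum_lower` needs only the numerical inequality for
ANY such pair. -/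

/-- The forward `β`-sieve solution with `κ = 1`, `β = 2`, `A = 2e^γ` satisfies Iwaniec's system.
[cite: IwaniecInventiones1978, Lemma 2] -/
theorem isLinearSieveFunctions_betaSieveForward :
    IsLinearSieveFunctions (Literature.NumberTheory.Sieve.BetaSieveForward.upper 1 2 sieveA)
      (Literature.NumberTheory.Sieve.BetaSieveForward.lower 1 2 sieveA) where
  continuousOn_upper := Literature.NumberTheory.Sieve.BetaSieveForward.continuousOn_upper (by norm_num)
  continuousOn_lower := Literature.NumberTheory.Sieve.BetaSieveForward.continuousOn_lower (by norm_num)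
  upper_eq s hs0 hs3 := by
    rw [Literature.NumberTheory.Sieve.BetaSieveForward.upper_eq (by norm_num; exact hs3), Real.rpow_neg_one, sieveA]
    field_simp
  lower_eq s hs0 hs2 := by
    rw [Literature.NumberTheory.Sieve.BetaSieveForward.lower_eq (by exact hs2), mul_zero]
  hasDerivAt_upper s hs := by
    have h := Literature.NumberTheory.Sieve.BetaSieveForward.hasDerivAt_upper (κ := 1) (β := 2) (A := sieveA) (by norm_num)
      (s := s) (by norm_num; exact hs)
    simp only [Real.rpow_one, sub_self, Real.rpow_zero, one_mul] at h
    exact h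
  hasDerivAt_lower s hs := by
    have h := Literature.NumberTheory.Sieve.BetaSieveForward.hasDerivAt_lower (κ := 1) (β := 2) (A := sieveA) (by norm_num)
      (s := s) hs
    simp only [Real.rpow_one, sub_self, Real.rpow_zero, one_mul] at h
    exact h

/-- **Existence of the linear-sieve functions — PROVED** (so the facts quantified over
`IsLinearSieveFunctions` are not vacuous). [cite: IwaniecInventiones1978, Lemma 2] -/
theorem exists_isLinearSieveFunctions : ∃ F f : ℝ → ℝ, IsLinearSieveFunctions F f :=
  ⟨_, _, isLinearSieveFunctions_betaSieveForward⟩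

/-- **(2) from Proposition 2 and the numerics, for ANY solution — PROVED.**
`proposition2_upper → proposition2_lower → (∀ F f, IsLinearSieveFunctions F f →
e^γ/770 < f(16/3) − T3 − T4 − T5) → weightedSum_lower`, the pair `(F, f)` being supplied by
`exists_isLinearSieveFunctions`. [cite: IwaniecInventiones1978, §6] -/
theorem weightedSum_lower_of_prop2_of_numerics'_const (h2u : proposition2_upper)
    (h2l : proposition2_lower_const)
    (hnum : ∀ F f : ℝ → ℝ, IsLinearSieveFunctions F f →
      Real.exp Real.eulerMascheroniConstant / 770 <
        f (16 / 3)
          - (∫ u in (1 / 5 : ℝ)..(1 / 2), (1 - 2 * u) * F ((16 / 15 - u) / u) * ((1 / 5) / u) / u)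
          - (∫ u in (1 / 5 : ℝ)..(1 / 2), F (5 * (16 / 15 - u)))
          - (∫ u in (1 / 2 : ℝ)..1, (1 - u) * F (5 * (16 / 15 - u)) / u)) :
    weightedSum_lower := by
  obtain ⟨F, f, h⟩ := exists_isLinearSieveFunctions
  exact weightedSum_lower_of_prop2_of_numerics_const h2u h2l h (hnum F f h)

/-- **(2) from Proposition 2 and the numerics, for ANY solution — PROVED.**
`proposition2_upper → proposition2_lower → (∀ F f, IsLinearSieveFunctions F f →
e^γ/770 < f(16/3) − T3 − T4 − T5) → weightedSum_lower`, the pair `(F, f)` being supplied by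
`exists_isLinearSieveFunctions`. [cite: IwaniecInventiones1978, §6] -/
theorem weightedSum_lower_of_prop2_of_numerics' (h2u : proposition2_upper)
    (h2l : proposition2_lower)
    (hnum : ∀ F f : ℝ → ℝ, IsLinearSieveFunctions F f →
      Real.exp Real.eulerMascheroniConstant / 770 <
        f (16 / 3)
          - (∫ u in (1 / 5 : ℝ)..(1 / 2), (1 - 2 * u) * F ((16 / 15 - u) / u) * ((1 / 5) / u) / u)
          - (∫ u in (1 / 5 : ℝ)..(1 / 2), F (5 * (16 / 15 - u)))
          - (∫ u in (1 / 2 : ℝ)..1, (1 - u) * F (5 * (16 / 15 - u)) / u)) :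
    weightedSum_lower :=
  weightedSum_lower_of_prop2_of_numerics'_const h2u h2l.const hnum


/-- **`RhoMertens` — DISCHARGED.**  `∑_{p ≤ t} ρ(p)/p − log log t` converges as `t → ∞`
(`ρ(p)` = number of roots of `n² + 1 ≡ 0 (mod p)`): the `_holds` form of
`tendsto_sum_primesLE_rho_div_sub_loglog`, i.e. Mertens' second theorem with its constant
(`Literature.NumberTheory.LFunctions.Mertens.tendsto_primeRecipSum_sub_loglog`) combined with the
convergence of `∑_p (1 − ρ(p))/p` (AZFG 2020 (5.4.4),
`AZFG2020_tendsto_sum_sub_omega_div_holds`), both proved in the tree.  This is the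
partial-summation input "`∑_{p ≤ t} ρ(p)/p = log log t + b + o(1)`" used on p. 186 of
Iwaniec (1978) to replace the prime sums of §6 by integrals.
[cite: IwaniecInventiones1978, §6 p. 186] -/
theorem RhoMertens_holds : RhoMertens := tendsto_sum_primesLE_rho_div_sub_loglog


end Literature.NumberTheory.Sieve.Iwaniec1978

end
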